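import Mathlib
import Literature.NumberTheory.Sieve.SieveFrameworkProofs
import HarnessLib

/-!
# The Maynard–Tao sieve: the bilinear forms of Lemmas 5.1–5.2 in the variables `y_r`, `y^{(m)}_r`

Topic `Literature/NumberTheory/Sieve`. The purely arithmetical (finite, `N`-free) part of
J. Maynard, *Small gaps between primes*, Ann. of Math. 181 (2015), §5 "Selberg sieve
manipulations", Lemmas 5.1 and 5.2: the change of variables `λ ↔ y` and the evaluation of the
bilinear forms `Σ'_{d,e} λ_d λ_e / ∏ᵢ [dᵢ, eᵢ]` (main term of `S₁`) and
`Σ'_{d,e: d_m = e_m = 1} λ_d λ_e / ∏ᵢ φ([dᵢ, eᵢ])` (main term of `S₂^{(m)}`) as a diagonal sum plus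
an error, for an ARBITRARY function `y` supported on "good" tuples (product squarefree and coprime to
`W`) of a box `[1, B]^k`. This is groundwork for the discharge of
`Literature.NumberTheory.Sieve.frequently_card_primes_ge_of_maynardFunctional` (Maynard's Prop. 4.2); the counting of
`n ∈ [N, 2N)` (the rest of Lemmas 5.1–5.2) and the analytic evaluation (§6) are in sequel files.

## Contents and the printed argument

* Tuples: `box k B`, `IsGood W r` (Maynard: "`y_{r₁…r_k}` supported on `r = ∏ rᵢ` square-free
  and coprime to `W`"), `boxG`, the good scalars `G1 W B`.
* `lam B y d` — **λ in terms of y**, Maynard (5.10):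
  `λ_{d} = (∏ μ(dᵢ) dᵢ) Σ_{dᵢ ∣ rᵢ} y_r / ∏ φ(rᵢ)`; `sum_lam_div_prod_eq` — the inversion (5.8)/(5.9):
  `Σ_{Aᵢ ∣ dᵢ} λ_d/∏dᵢ = (∏μ(Aᵢ)) y_A/∏φ(Aᵢ)` (via `Σ_{A ∣ d ∣ r} μ(d) = μ(A)[r = A]`,
  `sum_divisors_filter_dvd_moebius`).
* The bilinear forms, for a general pair `(ψ, ρ)` of multiplicative functions with
  `ψ(n) = Σ_{u∣n} ρ(u)` on good scalars (`(id, φ)` for `S₁` by (5.5), `(φ, g)`, `g(p) = p − 2`, for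
  `S₂^{(m)}` by (5.22)): with `S(A) = Σ_{A∣d} Λ_d/∏ψ(dᵢ)` and `Y_A = (∏μ(Aᵢ)ρ(Aᵢ)) S(A)`,
  - `term_expand`, `bilinear_rearrange` ((5.5)–(5.8) / (5.22)–(5.24)):
    `Σ'_{d,e} Λ_dΛ_e/∏ψ([dᵢ,eᵢ]) = Σ_u Σ_s ∏ρ(uᵢ) ∏μ(s_{i,j}) S(A(u,s)) S(B(u,s))`,
    `A(u,s)ᵢ = lcm(uᵢ, s_{i,·})`, `B(u,s)ⱼ = lcm(uⱼ, s_{·,j})` (`rowT`, `colT`), the `s_{i,j}` indexed by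
    `OffDiag k = {(i,j) : i ≠ j}`; here `[(dᵢ,eⱼ)=1] = Σ_{s∣(dᵢ,eⱼ)} μ(s)` and
    `1/ψ([a,b]) = Σ_{u∣(a,b)} ρ(u)/(ψ(a)ψ(b))`;
  - `coprime_of_isGood_rowT_colT` — Maynard's remark that `s_{i,j}` may be restricted to be
    coprime to `uᵢ, uⱼ, s_{i,a}, s_{b,j}` ("these terms have no contribution"), proved here as:
    if `A(u,s)` and `B(u,s)` are both good then the whole family `(uᵢ), (s_p)` is pairwise coprime,
    whence `∏ρ(A(u,s)ᵢ) = ∏ρ(uᵢ)∏ρ(s_p)` (`prod_rho_rowT_eq`);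
  - `diag_term_eq` (`s ≡ 1` gives `Y_u²/∏ρ(uᵢ)`), `abs_offdiag_term_le`, and
    `abs_bilinear_sub_diag_le` — (5.13)–(5.14) / (5.25)–(5.26):
    `|Σ' − Σ_u Y_u²/∏ρ(uᵢ)| ≤ Y_max² L_ρ^k (Z_ρ^{k²−k} − 1)`, `L_ρ = Σ_{u≤B good} 1/ρ(u)`,
    `Z_ρ = Σ_{s ≤ B good} 1/ρ(s)²` (Maynard bounds `Z_ρ^{k²−k} − 1 ≪ 1/D₀` using `(s, W) = 1 ⇒ s > D₀`;
    that step is left to the sequel, where `W = ∏_{p ≤ D₀} p`).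
* Instances: `totAF = φ`, `idAF = id`, `gAF = g` with `sum_divisors_totAF`, `sum_divisors_gAF`;
  `Yv_lam_eq : Y = y` for `(id, φ)`; `abs_S1main_sub_le` (Lemma 5.1 main term, error
  `y_max² L^k (Z^K − 1)`, i.e. `≪ k²/D₀` of the main term as printed) and, with
  `lamM B y m d = λ_d [d_m = 1]` and `ym = y^{(m)}` ((5.21)), `abs_S2main_sub_le` (Lemma 5.2 main
  term, via the slot version `abs_bilinear_sub_diag_le_slot`: only `u` with `u_m = 1` contribute,
  error `(y^{(m)}_max)² L_g^{k−1} (Z_g^K − 1)`, the printed exponent `k − 1`).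
* `abs_lam_le` — `λ_max ≤ y_max L^{2k}`, a crude but sufficient form of (5.9)
  (`d/φ(d) = Σ_{e∣d} 1/φ(e) ≤ L` for good `d ≤ B`, `sum_divisors_inv_totient`).

Design: all sums are finite sums over the box; `μ` is Mathlib's `ArithmeticFunction.moebius` cast
to `ℝ`; no asymptotics appear in this file. Relation to the tree: the weights of Prop. 4.1,
`Literature.maynardWeight k F R W` (`MaynardTao.lean`), are `lam ⌊R⌋₊ y_F` for
`y_F r = μ(∏rᵢ)² 1[(rᵢ,W)=1 ∀i] (1_{R_k}F)(log rᵢ/log R)` (this is `Literature.NumberTheory.Sieve.maynardY_eq` of the sibling file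
`MaynardSieveWeights.lean`, part of the Prop. 4.1 effort `MaynardSieve.lean` /
`MaynardSieveTuples.lean`); the results here are stated for an arbitrary `y` so as to serve both
that effort (the cores of Lemmas 5.1–5.3) and step-function choices of `y`.

## References

* J. Maynard, *Small gaps between primes*, Ann. of Math. (2) 181 (2015), 383–413,
  doi:10.4007/annals.2015.181.1.7 = arXiv:1311.4600v3, §5, Lemmas 5.1–5.2, displays (5.4)–(5.26).
  [cite: MaynardAnnals2015]
* D. H. J. Polymath, *Variants of the Selberg sieve, and bounded intervals containing many primes*,
  Res. Math. Sci. 1:12 (2014), §4 (the same manipulations). [cite: Polymath8b2014]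
-/

open Finset Real ArithmeticFunction

open scoped ArithmeticFunction.Moebius ArithmeticFunction.Omega

namespace Literature.NumberTheory.Sieve

namespace MaynardSieve

variable {k : ℕ}

/-! ### Tuples -/

/-- The finite box of `k`-tuples `1 ≤ rᵢ ≤ B`. [folklore] -/
def box (k B : ℕ) : Finset (Fin k → ℕ) := Fintype.piFinset fun _ => Finset.Icc 1 B

/-- Membership in the box. [folklore] -/
theorem mem_box {B : ℕ} {r : Fin k → ℕ} : r ∈ box k B ↔ ∀ i, 1 ≤ r i ∧ r i ≤ B := by
  simp [box, Fintype.mem_piFinset]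

/-- A tuple is *good* (for the modulus `W`) if the product of its entries is squarefree and coprime
to `W` — the support condition on Maynard's variables `y_{r₁,…,r_k}` (Maynard 2015, §5, first
paragraph and (6.3)). [cite: MaynardAnnals2015, §5 (support of λ and y)] -/
def IsGood (W : ℕ) (r : Fin k → ℕ) : Prop := Squarefree (∏ i, r i) ∧ (∏ i, r i).Coprime W

/-- Goodness is decidable. [folklore] -/
instance decidableIsGood (W : ℕ) : DecidablePred (IsGood (k := k) W) := fun r => by
  unfold IsGood; infer_instance

/-- The product of a good tuple is squarefree. [folklore] -/
theorem IsGood.squarefree {W : ℕ} {r : Fin k → ℕ} (h : IsGood W r) : Squarefree (∏ i, r i) := h.1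

/-- The product of a good tuple is coprime to `W`. [folklore] -/
theorem IsGood.coprime {W : ℕ} {r : Fin k → ℕ} (h : IsGood W r) : (∏ i, r i).Coprime W := h.2

/-- Each entry of a good tuple is squarefree. [folklore] -/
theorem IsGood.squarefree_apply {W : ℕ} {r : Fin k → ℕ} (h : IsGood W r) (i : Fin k) :
    Squarefree (r i) :=
  h.1.squarefree_of_dvd (Finset.dvd_prod_of_mem _ (Finset.mem_univ i))

/-- Each entry of a good tuple is coprime to `W`. [folklore] -/
theorem IsGood.coprime_apply {W : ℕ} {r : Fin k → ℕ} (h : IsGood W r) (i : Fin k) :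
    (r i).Coprime W :=
  Nat.Coprime.coprime_dvd_left (Finset.dvd_prod_of_mem _ (Finset.mem_univ i)) h.2

/-- Each entry of a good tuple is nonzero. [folklore] -/
theorem IsGood.ne_zero {W : ℕ} {r : Fin k → ℕ} (h : IsGood W r) (i : Fin k) : r i ≠ 0 :=
  (h.squarefree_apply i).ne_zero

/-- Distinct entries of a good tuple are coprime. [folklore] -/
theorem IsGood.coprime_of_ne {W : ℕ} {r : Fin k → ℕ} (h : IsGood W r) {i j : Fin k} (hij : i ≠ j) :
    (r i).Coprime (r j) := by
  have : r i * r j ∣ ∏ l, r l := by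
    rw [← Finset.prod_pair hij]
    exact Finset.prod_dvd_prod_of_subset _ _ _ (by simp [Finset.subset_iff])
  exact Nat.coprime_of_squarefree_mul (h.1.squarefree_of_dvd this)

/-- A good tuple divided entrywise stays good: if `A ∣ r` entrywise and `r` is good then `A` is
good. [folklore] -/
theorem IsGood.of_dvd {W : ℕ} {A r : Fin k → ℕ} (h : IsGood W r) (hA : ∀ i, A i ∣ r i) :
    IsGood W A := by
  have hdvd : ∏ i, A i ∣ ∏ i, r i := Finset.prod_dvd_prod_of_dvd _ _ fun i _ => hA i
  exact ⟨h.1.squarefree_of_dvd hdvd, Nat.Coprime.coprime_dvd_left hdvd h.2⟩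


/-! ### One-variable Möbius identities -/

/-- For `r` squarefree: `Σ_{A ∣ d ∣ r} μ(d) = μ(A) [r = A]` (Möbius inversion on the
interval `[A, r]` of the divisor lattice). A thin corollary of the tree's
`Literature.NumberTheory.Sieve.sum_divisors_ite_dvd_moebius` (`SieveFrameworkProofs.lean`; see also
`Literature.NumberTheory.Sieve.sum_divisors_moebius_real` there for `Σ_{d∣n} μ(d) = [n = 1]`). [folklore] -/
theorem sum_divisors_filter_dvd_moebius {A r : ℕ} (hr : Squarefree r) :
    ∑ d ∈ r.divisors with A ∣ d, ((μ d : ℤ) : ℝ) = if r = A then ((μ A : ℤ) : ℝ) else 0 := by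
  rw [Finset.sum_filter, Literature.NumberTheory.Sieve.sum_divisors_ite_dvd_moebius hr A]
  split_ifs with h
  · rw [h]
  · rfl

/-! ### Maynard's weights `λ_d` from the diagonal variables `y_r` -/

/-- **Maynard's `λ` in terms of `y`** (Maynard 2015, (5.10): `λ_{d₁…d_k} =
(∏ μ(dᵢ)dᵢ) Σ_{dᵢ∣rᵢ} y_r/∏ φ(rᵢ)`), the sum running over the box `1 ≤ rᵢ ≤ B`.
[cite: MaynardAnnals2015, (5.10)] -/
noncomputable def lam (B : ℕ) (y : (Fin k → ℕ) → ℝ) (d : Fin k → ℕ) : ℝ :=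
  (∏ i, ((μ (d i) : ℤ) : ℝ) * (d i : ℝ)) *
    ∑ r ∈ (box k B).filter (fun r => ∀ i, d i ∣ r i), y r / ∏ i, ((r i).totient : ℝ)

/-- Unfolding `lam`. [folklore] -/
theorem lam_def (B : ℕ) (y : (Fin k → ℕ) → ℝ) (d : Fin k → ℕ) :
    lam B y d = (∏ i, ((μ (d i) : ℤ) : ℝ) * (d i : ℝ)) *
      ∑ r ∈ (box k B).filter (fun r => ∀ i, d i ∣ r i), y r / ∏ i, ((r i).totient : ℝ) := rfl

/-- The support hypothesis on `y`: `y_r = 0` unless `r` lies in the box and is good. This is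
Maynard's "`y_{r₁,…,r_k}` supported on `r` with `∏ rᵢ` square-free, `< R` and coprime to `W`"
(Maynard 2015, after (5.8)). [cite: MaynardAnnals2015, §5 after (5.8)] -/
def SupportedOn (W B : ℕ) (y : (Fin k → ℕ) → ℝ) : Prop :=
  ∀ r, y r ≠ 0 → r ∈ box k B ∧ IsGood W r

/-- The tuples `d` of the box with `Aᵢ ∣ dᵢ ∣ rᵢ` form the product of the divisor intervals.
[folklore] -/
theorem filter_box_dvd_dvd_eq {B : ℕ} {A r : Fin k → ℕ} (hr : r ∈ box k B) :
    (box k B).filter (fun d => (∀ i, A i ∣ d i) ∧ ∀ i, d i ∣ r i) =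
      Fintype.piFinset fun i => (r i).divisors.filter (A i ∣ ·) := by
  ext d
  simp only [Finset.mem_filter, mem_box, Fintype.mem_piFinset, Nat.mem_divisors]
  rw [mem_box] at hr
  constructor
  · rintro ⟨-, hA, hd⟩ i
    exact ⟨⟨hd i, by have := (hr i).1; omega⟩, hA i⟩
  · intro h
    refine ⟨fun i => ⟨?_, ?_⟩, fun i => (h i).2, fun i => (h i).1.1⟩
    · exact Nat.pos_of_ne_zero fun h0 => (h i).1.2 (Nat.eq_zero_of_zero_dvd (h0 ▸ (h i).1.1))
    · exact (Nat.le_of_dvd (hr i).1 (h i).1.1).trans (hr i).2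

/-- **The inversion formula** (Maynard 2015, (5.9) read backwards): for `y` supported on good
tuples of the box and any tuple `A`,
`Σ_{d : Aᵢ ∣ dᵢ} λ_d / ∏ dᵢ = (∏ μ(Aᵢ)) y_A / ∏ φ(Aᵢ)`. [cite: MaynardAnnals2015, (5.8)–(5.10)] -/
theorem sum_lam_div_prod_eq {W B : ℕ} {y : (Fin k → ℕ) → ℝ} (hy : SupportedOn W B y)
    (A : Fin k → ℕ) :
    ∑ d ∈ (box k B).filter (fun d => ∀ i, A i ∣ d i), lam B y d / ∏ i, (d i : ℝ) =
      (∏ i, ((μ (A i) : ℤ) : ℝ)) * y A / ∏ i, ((A i).totient : ℝ) := by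
  -- Step 1: `λ_d / ∏ dᵢ = (∏ μ(dᵢ)) Σ_{d ∣ r} y_r / ∏ φ(rᵢ)` on the box.
  have step1 : ∀ d ∈ (box k B).filter (fun d => ∀ i, A i ∣ d i),
      lam B y d / ∏ i, (d i : ℝ) = ∑ r ∈ (box k B).filter (fun r => ∀ i, d i ∣ r i),
        (∏ i, ((μ (d i) : ℤ) : ℝ)) * (y r / ∏ i, ((r i).totient : ℝ)) := by
    intro d hd
    rw [Finset.mem_filter, mem_box] at hd
    have hd0 : ∏ i, (d i : ℝ) ≠ 0 := Finset.prod_ne_zero_iff.2 fun i _ => by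
      have := (hd.1 i).1; positivity
    rw [lam_def, Finset.prod_mul_distrib, mul_right_comm, mul_div_cancel_right₀ _ hd0, Finset.mul_sum]
  rw [Finset.sum_congr rfl step1]
  -- Step 2: write both sums over the box with indicators and swap.
  have step2 : ∑ d ∈ (box k B).filter (fun d => ∀ i, A i ∣ d i),
      ∑ r ∈ (box k B).filter (fun r => ∀ i, d i ∣ r i),
        (∏ i, ((μ (d i) : ℤ) : ℝ)) * (y r / ∏ i, ((r i).totient : ℝ)) =
      ∑ r ∈ box k B, (y r / ∏ i, ((r i).totient : ℝ)) *
        ∑ d ∈ (box k B).filter (fun d => (∀ i, A i ∣ d i) ∧ ∀ i, d i ∣ r i),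
          ∏ i, ((μ (d i) : ℤ) : ℝ) := by
    calc ∑ d ∈ (box k B).filter (fun d => ∀ i, A i ∣ d i),
          ∑ r ∈ (box k B).filter (fun r => ∀ i, d i ∣ r i),
            (∏ i, ((μ (d i) : ℤ) : ℝ)) * (y r / ∏ i, ((r i).totient : ℝ))
        = ∑ d ∈ box k B, ∑ r ∈ box k B, (if (∀ i, A i ∣ d i) ∧ (∀ i, d i ∣ r i) then
            (∏ i, ((μ (d i) : ℤ) : ℝ)) * (y r / ∏ i, ((r i).totient : ℝ)) else 0) := by
          rw [Finset.sum_filter]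
          refine Finset.sum_congr rfl fun d _ => ?_
          rw [Finset.sum_filter]
          split_ifs with h1
          · refine Finset.sum_congr rfl fun r _ => ?_
            by_cases h2 : ∀ i, d i ∣ r i
            · rw [if_pos h2, if_pos ⟨h1, h2⟩]
            · rw [if_neg h2, if_neg (fun h => h2 h.2)]
          · symm
            refine Finset.sum_eq_zero fun r _ => ?_
            rw [if_neg (fun h => h1 h.1)]
      _ = ∑ r ∈ box k B, ∑ d ∈ box k B, (if (∀ i, A i ∣ d i) ∧ (∀ i, d i ∣ r i) then
            (∏ i, ((μ (d i) : ℤ) : ℝ)) * (y r / ∏ i, ((r i).totient : ℝ)) else 0) :=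
          Finset.sum_comm
      _ = _ := by
          refine Finset.sum_congr rfl fun r _ => ?_
          rw [Finset.mul_sum, Finset.sum_filter]
          refine Finset.sum_congr rfl fun d _ => ?_
          split_ifs <;> ring
  rw [step2]
  -- Step 3: the inner sum is `(∏ μ(Aᵢ)) [r = A]` whenever `y r ≠ 0`.
  have step3 : ∀ r ∈ box k B, (y r / ∏ i, ((r i).totient : ℝ)) *
      ∑ d ∈ (box k B).filter (fun d => (∀ i, A i ∣ d i) ∧ ∀ i, d i ∣ r i),
        ∏ i, ((μ (d i) : ℤ) : ℝ) =
      if r = A then (∏ i, ((μ (A i) : ℤ) : ℝ)) * y A / ∏ i, ((A i).totient : ℝ) else 0 := by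
    intro r hr
    by_cases hy0 : y r = 0
    · rw [hy0, zero_div, zero_mul]
      split_ifs with h
      · subst h; rw [hy0, mul_zero, zero_div]
      · rfl
    have hgood := (hy r hy0).2
    rw [filter_box_dvd_dvd_eq hr,
      (Finset.prod_univ_sum (fun i => (r i).divisors.filter (A i ∣ ·))
        (fun _ n => ((μ n : ℤ) : ℝ))).symm]
    have hinner : ∀ i, ∑ d ∈ (r i).divisors.filter (A i ∣ ·), ((μ d : ℤ) : ℝ) =
        if A i ∣ r i then (if r i = A i then ((μ (A i) : ℤ) : ℝ) else 0) else 0 := by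
      intro i
      by_cases hAi : A i ∣ r i
      · rw [if_pos hAi, sum_divisors_filter_dvd_moebius (hgood.squarefree_apply i)]
      · rw [if_neg hAi]
        refine Finset.sum_eq_zero fun d hd => ?_
        rw [Finset.mem_filter, Nat.mem_divisors] at hd
        exact absurd (dvd_trans hd.2 hd.1.1) hAi
    simp_rw [hinner]
    by_cases hrA : r = A
    · rw [if_pos hrA]
      have hprod : (∏ i, (if A i ∣ r i then (if r i = A i then ((μ (A i) : ℤ) : ℝ) else 0)
          else 0)) = ∏ i, ((μ (A i) : ℤ) : ℝ) := by
        refine Finset.prod_congr rfl fun i _ => ?_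
        have h1 : r i = A i := congrFun hrA i
        rw [if_pos (by rw [h1]), if_pos h1]
      rw [hprod, hrA]
      ring
    · rw [if_neg hrA]
      -- some coordinate differs, so the product has a zero factor
      obtain ⟨i, hi⟩ := Function.ne_iff.1 hrA
      have hzero : (∏ i, (if A i ∣ r i then (if r i = A i then ((μ (A i) : ℤ) : ℝ) else 0)
          else 0)) = 0 := by
        apply Finset.prod_eq_zero (Finset.mem_univ i)
        rw [if_neg hi, ite_self]
      rw [hzero, mul_zero]
  rw [Finset.sum_congr rfl step3, Finset.sum_ite_eq']
  split_ifs with hA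
  · rfl
  · -- `A ∉ box`: then `y A = 0`
    have : y A = 0 := by
      by_contra h
      exact hA (hy A h).1
    rw [this, mul_zero, zero_div]


/-! ### The bilinear forms of Lemmas 5.1 and 5.2

We treat `Σ'_{d,e} Λ_d Λ_e / ∏ᵢ ψ([dᵢ,eᵢ])` (the sum over pairs with `(dᵢ, eⱼ) = 1` for all `i ≠ j`)
for a multiplicative `ψ` with `ψ(n) = Σ_{u ∣ n} ρ(u)` on the relevant (squarefree, coprime to `W`)
integers: `(ψ, ρ) = (id, φ)` is the main term of `S₁` (Maynard (5.4)–(5.6)), `(ψ, ρ) = (φ, g)` with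
`g(p) = p − 2` that of `S₂^{(m)}` (Maynard (5.22)–(5.24)). -/

section Bilinear

/-- Off-diagonal index pairs `(i, j)`, `i ≠ j` (the indices of Maynard's variables `s_{i,j}`).
[cite: MaynardAnnals2015, proof of Lemma 5.1 (variables s_{i,j})] -/
abbrev OffDiag (k : ℕ) := {p : Fin k × Fin k // p.1 ≠ p.2}

/-- The good scalars `1 ≤ n ≤ B`, squarefree and coprime to `W`. [folklore] -/
def G1 (W B : ℕ) : Finset ℕ := (Finset.Icc 1 B).filter fun n => Squarefree n ∧ n.Coprime W

/-- Membership in `G1`. [folklore] -/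
theorem mem_G1 {W B n : ℕ} : n ∈ G1 W B ↔ (1 ≤ n ∧ n ≤ B) ∧ Squarefree n ∧ n.Coprime W := by
  simp [G1]

/-- The good tuples of the box. [folklore] -/
def boxG (k W B : ℕ) : Finset (Fin k → ℕ) := (box k B).filter (IsGood W)

/-- Membership in `boxG`. [folklore] -/
theorem mem_boxG {W B : ℕ} {r : Fin k → ℕ} : r ∈ boxG k W B ↔ r ∈ box k B ∧ IsGood W r := by
  simp [boxG]

/-- Entries of good tuples of the box are good scalars. [folklore] -/
theorem apply_mem_G1_of_mem_boxG {W B : ℕ} {r : Fin k → ℕ} (hr : r ∈ boxG k W B) (i : Fin k) :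
    r i ∈ G1 W B := by
  rw [mem_boxG, mem_box] at hr
  exact mem_G1.2 ⟨hr.1 i, hr.2.squarefree_apply i, hr.2.coprime_apply i⟩

/-- Good tuples of the box lie in the product of the good scalars. [folklore] -/
theorem boxG_subset_piFinset (k W B : ℕ) :
    boxG k W B ⊆ Fintype.piFinset fun _ : Fin k => G1 W B := fun _ hr =>
  Fintype.mem_piFinset.2 (apply_mem_G1_of_mem_boxG hr)

/-- The box of off-diagonal families of good scalars (the range of the `s_{i,j}`). [folklore] -/
def sboxG (k W B : ℕ) : Finset (OffDiag k → ℕ) := Fintype.piFinset fun _ => G1 W B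

variable (W B : ℕ) (ψ ρ : ArithmeticFunction ℝ) (cf : (Fin k → ℕ) → ℝ)

/-- `S(A) = Σ_{d good, Aᵢ ∣ dᵢ} Λ_d / ∏ ψ(dᵢ)` for coefficients `Λ = cf`. [folklore] -/
noncomputable def Ssum (A : Fin k → ℕ) : ℝ :=
  ∑ d ∈ (boxG k W B).filter (fun d => ∀ i, A i ∣ d i), cf d / ∏ i, ψ (d i)

/-- The diagonal variable attached to `Λ` and `(ψ, ρ)`:
`Y_A = (∏ μ(Aᵢ) ρ(Aᵢ)) Σ_{Aᵢ ∣ dᵢ} Λ_d / ∏ ψ(dᵢ)` — Maynard's `y` ((5.8), `(ψ,ρ) = (id, φ)`) and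
`y^{(m)}` ((5.21), `(ψ, ρ) = (φ, g)`, `Λ_d = λ_d [d_m = 1]`). [cite: MaynardAnnals2015, (5.8) and (5.21)] -/
noncomputable def Yv (A : Fin k → ℕ) : ℝ :=
  (∏ i, ((μ (A i) : ℤ) : ℝ) * ρ (A i)) * Ssum W B ψ cf A

variable {W B ψ ρ cf}

/-- The row tuple `Aᵢ = lcm(uᵢ, lcm_{j ≠ i} s_{i,j})` (Maynard's `a_j = u_j ∏_{i≠j} s_{j,i}`).
[cite: MaynardAnnals2015, proof of Lemma 5.1 (a_j)] -/
def rowT (u : Fin k → ℕ) (s : OffDiag k → ℕ) : Fin k → ℕ := fun i =>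
  Nat.lcm (u i) ((Finset.univ.filter fun p : OffDiag k => p.1.1 = i).lcm s)

/-- The column tuple `Bⱼ = lcm(uⱼ, lcm_{i ≠ j} s_{i,j})` (Maynard's `b_j = u_j ∏_{i≠j} s_{i,j}`).
[cite: MaynardAnnals2015, proof of Lemma 5.1 (b_j)] -/
def colT (u : Fin k → ℕ) (s : OffDiag k → ℕ) : Fin k → ℕ := fun j =>
  Nat.lcm (u j) ((Finset.univ.filter fun p : OffDiag k => p.1.2 = j).lcm s)

/-- `Aᵢ ∣ dᵢ` for all `i` iff `uᵢ ∣ dᵢ` for all `i` and `s_p ∣ d_{p.1}` for all `p`. [folklore] -/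
theorem rowT_dvd_iff (u d : Fin k → ℕ) (s : OffDiag k → ℕ) :
    (∀ i, rowT u s i ∣ d i) ↔ (∀ i, u i ∣ d i) ∧ ∀ p : OffDiag k, s p ∣ d p.1.1 := by
  simp only [rowT, Nat.lcm_dvd_iff, Finset.lcm_dvd_iff, Finset.mem_filter, Finset.mem_univ,
    true_and]
  constructor
  · intro h
    exact ⟨fun i => (h i).1, fun p => (h p.1.1).2 p rfl⟩
  · rintro ⟨h1, h2⟩ i
    exact ⟨h1 i, fun p hp => hp ▸ h2 p⟩

/-- `Bⱼ ∣ eⱼ` for all `j` iff `uⱼ ∣ eⱼ` for all `j` and `s_p ∣ e_{p.2}` for all `p`. [folklore] -/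
theorem colT_dvd_iff (u e : Fin k → ℕ) (s : OffDiag k → ℕ) :
    (∀ j, colT u s j ∣ e j) ↔ (∀ j, u j ∣ e j) ∧ ∀ p : OffDiag k, s p ∣ e p.1.2 := by
  simp only [colT, Nat.lcm_dvd_iff, Finset.lcm_dvd_iff, Finset.mem_filter, Finset.mem_univ,
    true_and]
  constructor
  · intro h
    exact ⟨fun i => (h i).1, fun p => (h p.1.2).2 p rfl⟩
  · rintro ⟨h1, h2⟩ i
    exact ⟨h1 i, fun p hp => hp ▸ h2 p⟩


/-- Divisors of good scalars are good scalars. [folklore] -/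
theorem mem_G1_of_dvd {W B a n : ℕ} (hn : n ∈ G1 W B) (ha : a ∣ n) : a ∈ G1 W B := by
  rw [mem_G1] at hn ⊢
  have hn0 : n ≠ 0 := by have := hn.1.1; omega
  have ha0 : a ≠ 0 := fun h => hn0 (zero_dvd_iff.1 (h ▸ ha))
  exact ⟨⟨Nat.pos_of_ne_zero ha0, (Nat.le_of_dvd (by omega) ha).trans hn.1.2⟩,
    hn.2.1.squarefree_of_dvd ha, Nat.Coprime.coprime_dvd_left ha hn.2.2⟩

section Hyps

variable {W B : ℕ} {ψ ρ : ArithmeticFunction ℝ}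

/-- The local identity `1/ψ([a,b]) = ψ((a,b))/(ψ(a)ψ(b)) = (Σ_{u ∣ (a,b)} ρ(u))/(ψ(a)ψ(b))`
(Maynard (5.5): `1/[dᵢ,eᵢ] = (1/dᵢeᵢ) Σ_{uᵢ ∣ dᵢ,eᵢ} φ(uᵢ)`; (5.22) with `φ, g`).
[cite: MaynardAnnals2015, (5.5) and (5.22)] -/
theorem inv_psi_lcm_eq (hψ : ψ.IsMultiplicative)
    (hρψ : ∀ n ∈ G1 W B, ∑ u ∈ n.divisors, ρ u = ψ n)
    (hψpos : ∀ n ∈ G1 W B, 0 < ψ n) {a b : ℕ} (ha : a ∈ G1 W B) (hb : b ∈ G1 W B) :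
    1 / ψ (Nat.lcm a b) = (∑ u ∈ (Nat.gcd a b).divisors, ρ u) / (ψ a * ψ b) := by
  have hg : Nat.gcd a b ∈ G1 W B := mem_G1_of_dvd ha (Nat.gcd_dvd_left a b)
  have hmul := hψ.lcm_apply_mul_gcd_apply (x := a) (y := b)
  have hgpos := hψpos _ hg
  have hapos := hψpos _ ha
  have hbpos := hψpos _ hb
  have hl : ψ (Nat.lcm a b) ≠ 0 := fun h => by
    rw [h, zero_mul] at hmul; linarith [mul_pos hapos hbpos]
  rw [hρψ _ hg, div_eq_div_iff hl (by positivity), one_mul, ← hmul]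
  ring

/-- `[(a, b) = 1] = Σ_{s ∣ (a,b)} μ(s)`. [folklore] -/
theorem ite_coprime_eq_sum_moebius (a b : ℕ) :
    (if a.Coprime b then (1 : ℝ) else 0) = ∑ s ∈ (Nat.gcd a b).divisors, ((μ s : ℤ) : ℝ) := by
  rw [Literature.NumberTheory.Sieve.sum_divisors_moebius_real]

/-- The row/column divisibility conditions attached to `(u, s)`. [folklore] -/
def RowCond (u : Fin k → ℕ) (s : OffDiag k → ℕ) (d : Fin k → ℕ) : Prop :=
  (∀ i, u i ∣ d i) ∧ ∀ p : OffDiag k, s p ∣ d p.1.1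

/-- The column divisibility condition attached to `(u, s)`. [folklore] -/
def ColCond (u : Fin k → ℕ) (s : OffDiag k → ℕ) (e : Fin k → ℕ) : Prop :=
  (∀ j, u j ∣ e j) ∧ ∀ p : OffDiag k, s p ∣ e p.1.2

/-- The row condition is decidable. [folklore] -/
instance decidableRowCond (u : Fin k → ℕ) (s : OffDiag k → ℕ) : DecidablePred (RowCond u s) :=
  fun _ => by unfold RowCond; infer_instance

/-- The column condition is decidable. [folklore] -/
instance decidableColCond (u : Fin k → ℕ) (s : OffDiag k → ℕ) : DecidablePred (ColCond u s) :=
  fun _ => by unfold ColCond; infer_instance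

/-- The `u`-range: tuples dividing `gcd(dᵢ, eᵢ)` entrywise are exactly the good tuples with
`uᵢ ∣ dᵢ`, `uᵢ ∣ eᵢ`. [folklore] -/
theorem piFinset_gcd_divisors_eq {d e : Fin k → ℕ} (hd : d ∈ boxG k W B) :
    (Fintype.piFinset fun i => (Nat.gcd (d i) (e i)).divisors) =
      (boxG k W B).filter fun u => ∀ i, u i ∣ d i ∧ u i ∣ e i := by
  ext u
  simp only [Fintype.mem_piFinset, Nat.mem_divisors, Nat.dvd_gcd_iff, Finset.mem_filter, ne_eq,
    Nat.gcd_eq_zero_iff, not_and]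
  have hd' := hd
  rw [mem_boxG, mem_box] at hd'
  constructor
  · intro h
    have hdiv : ∀ i, u i ∣ d i ∧ u i ∣ e i := fun i => (h i).1
    refine ⟨?_, hdiv⟩
    rw [mem_boxG, mem_box]
    refine ⟨fun i => ⟨Nat.pos_of_ne_zero fun h0 => ?_, ?_⟩, hd'.2.of_dvd fun i => (hdiv i).1⟩
    · have := (hdiv i).1; rw [h0, zero_dvd_iff] at this; exact absurd this (by have := (hd'.1 i).1; omega)
    · exact (Nat.le_of_dvd (hd'.1 i).1 (hdiv i).1).trans (hd'.1 i).2
  · rintro ⟨-, h⟩ i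
    exact ⟨h i, fun h0 => absurd h0 (by have := (hd'.1 i).1; omega)⟩

/-- The `s`-range: families dividing `gcd(d_{p.1}, e_{p.2})` are exactly the families of good
scalars with `s_p ∣ d_{p.1}`, `s_p ∣ e_{p.2}`. [folklore] -/
theorem piFinset_gcd_divisors_eq' {d e : Fin k → ℕ} (hd : d ∈ boxG k W B) :
    (Fintype.piFinset fun p : OffDiag k => (Nat.gcd (d p.1.1) (e p.1.2)).divisors) =
      (sboxG k W B).filter fun s => ∀ p, s p ∣ d p.1.1 ∧ s p ∣ e p.1.2 := by
  ext s
  simp only [Fintype.mem_piFinset, Nat.mem_divisors, Nat.dvd_gcd_iff, Finset.mem_filter, ne_eq,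
    Nat.gcd_eq_zero_iff, not_and, sboxG]
  have hd' := hd
  rw [mem_boxG, mem_box] at hd'
  constructor
  · intro h
    refine ⟨fun p => mem_G1_of_dvd (apply_mem_G1_of_mem_boxG hd p.1.1) (h p).1.1, fun p => (h p).1⟩
  · rintro ⟨-, h⟩ p
    exact ⟨h p, fun h0 => absurd h0 (by have := (hd'.1 p.1.1).1; omega)⟩

/-- **Expansion of one term of the bilinear form** (Maynard (5.5)–(5.7) / (5.22)–(5.23)): for good
`d, e`,
`[(dᵢ,eⱼ)=1 ∀ i≠j] Λ_dΛ_e/∏ψ([dᵢ,eᵢ]) = Σ_{u,s} [u,s ∣ d (rows)] [u,s ∣ e (columns)] ∏ρ(uᵢ) ∏μ(s_p)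
(Λ_d/∏ψ(dᵢ)) (Λ_e/∏ψ(eᵢ))`. [cite: MaynardAnnals2015, (5.5)–(5.7)] -/
theorem term_expand (hψ : ψ.IsMultiplicative)
    (hρψ : ∀ n ∈ G1 W B, ∑ u ∈ n.divisors, ρ u = ψ n) (hψpos : ∀ n ∈ G1 W B, 0 < ψ n)
    (cf : (Fin k → ℕ) → ℝ) {d e : Fin k → ℕ} (hd : d ∈ boxG k W B) (he : e ∈ boxG k W B) :
    (if ∀ p : OffDiag k, (d p.1.1).Coprime (e p.1.2) then
        cf d * cf e / ∏ i, ψ (Nat.lcm (d i) (e i)) else 0) =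
      ∑ u ∈ boxG k W B, ∑ s ∈ sboxG k W B,
        if RowCond u s d ∧ ColCond u s e then
          (∏ i, ρ (u i)) * (∏ p, ((μ (s p) : ℤ) : ℝ)) * (cf d / ∏ i, ψ (d i)) * (cf e / ∏ i, ψ (e i))
        else 0 := by
  -- (A) the `ψ`-part
  have hdG := apply_mem_G1_of_mem_boxG hd
  have heG := apply_mem_G1_of_mem_boxG he
  have hA : (1 : ℝ) / ∏ i, ψ (Nat.lcm (d i) (e i)) =
      (∑ u ∈ Fintype.piFinset fun i => (Nat.gcd (d i) (e i)).divisors, ∏ i, ρ (u i)) /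
        ((∏ i, ψ (d i)) * ∏ i, ψ (e i)) := by
    rw [← Finset.prod_univ_sum, ← Finset.prod_mul_distrib, ← Finset.prod_div_distrib,
      one_div, ← Finset.prod_inv_distrib]
    refine Finset.prod_congr rfl fun i _ => ?_
    rw [← one_div]
    exact inv_psi_lcm_eq hψ hρψ hψpos (hdG i) (heG i)
  -- (B) the coprimality indicator
  have hB : (if ∀ p : OffDiag k, (d p.1.1).Coprime (e p.1.2) then (1 : ℝ) else 0) =
      ∑ s ∈ Fintype.piFinset fun p : OffDiag k => (Nat.gcd (d p.1.1) (e p.1.2)).divisors,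
        ∏ p, ((μ (s p) : ℤ) : ℝ) := by
    rw [← Finset.prod_univ_sum (fun p : OffDiag k => (Nat.gcd (d p.1.1) (e p.1.2)).divisors)
      (fun _ n => ((μ n : ℤ) : ℝ))]
    simp_rw [← ite_coprime_eq_sum_moebius]
    rw [Finset.prod_boole]
    simp
  -- combine
  have hψd : 0 < ∏ i, ψ (d i) := Finset.prod_pos fun i _ => hψpos _ (hdG i)
  have hψe : 0 < ∏ i, ψ (e i) := Finset.prod_pos fun i _ => hψpos _ (heG i)
  calc (if ∀ p : OffDiag k, (d p.1.1).Coprime (e p.1.2) then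
          cf d * cf e / ∏ i, ψ (Nat.lcm (d i) (e i)) else 0)
      = (if ∀ p : OffDiag k, (d p.1.1).Coprime (e p.1.2) then (1 : ℝ) else 0) *
          (cf d * cf e * (1 / ∏ i, ψ (Nat.lcm (d i) (e i)))) := by
        split_ifs <;> ring
    _ = (∑ s ∈ (sboxG k W B).filter (fun s => ∀ p, s p ∣ d p.1.1 ∧ s p ∣ e p.1.2),
          ∏ p, ((μ (s p) : ℤ) : ℝ)) *
          (cf d * cf e * ((∑ u ∈ (boxG k W B).filter (fun u => ∀ i, u i ∣ d i ∧ u i ∣ e i),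
            ∏ i, ρ (u i)) / ((∏ i, ψ (d i)) * ∏ i, ψ (e i)))) := by
        rw [hB, hA, piFinset_gcd_divisors_eq hd, piFinset_gcd_divisors_eq' hd]
    _ = ∑ u ∈ (boxG k W B).filter (fun u => ∀ i, u i ∣ d i ∧ u i ∣ e i),
          ∑ s ∈ (sboxG k W B).filter (fun s => ∀ p, s p ∣ d p.1.1 ∧ s p ∣ e p.1.2),
            (∏ i, ρ (u i)) * (∏ p, ((μ (s p) : ℤ) : ℝ)) * (cf d / ∏ i, ψ (d i)) *
              (cf e / ∏ i, ψ (e i)) := by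
        have hPd : (∏ i, ψ (d i)) ≠ 0 := hψd.ne'
        have hPe : (∏ i, ψ (e i)) ≠ 0 := hψe.ne'
        have e1 : (∑ s ∈ (sboxG k W B).filter (fun s => ∀ p, s p ∣ d p.1.1 ∧ s p ∣ e p.1.2),
            ∏ p, ((μ (s p) : ℤ) : ℝ)) *
            (cf d * cf e * ((∑ u ∈ (boxG k W B).filter (fun u => ∀ i, u i ∣ d i ∧ u i ∣ e i),
              ∏ i, ρ (u i)) / ((∏ i, ψ (d i)) * ∏ i, ψ (e i)))) =
            ((∑ u ∈ (boxG k W B).filter (fun u => ∀ i, u i ∣ d i ∧ u i ∣ e i), ∏ i, ρ (u i)) *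
              ∑ s ∈ (sboxG k W B).filter (fun s => ∀ p, s p ∣ d p.1.1 ∧ s p ∣ e p.1.2),
                ∏ p, ((μ (s p) : ℤ) : ℝ)) * (cf d / (∏ i, ψ (d i)) * (cf e / ∏ i, ψ (e i))) := by
          set U := ∑ u ∈ (boxG k W B).filter (fun u => ∀ i, u i ∣ d i ∧ u i ∣ e i), ∏ i, ρ (u i)
          set Sm := ∑ s ∈ (sboxG k W B).filter (fun s => ∀ p, s p ∣ d p.1.1 ∧ s p ∣ e p.1.2),
            ∏ p, ((μ (s p) : ℤ) : ℝ)
          simp only [div_eq_mul_inv, mul_inv]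
          ring
        rw [e1, Finset.sum_mul_sum, Finset.sum_mul]
        refine Finset.sum_congr rfl fun u _ => ?_
        rw [Finset.sum_mul]
        refine Finset.sum_congr rfl fun s _ => ?_
        ring
    _ = _ := by
        rw [Finset.sum_filter]
        refine Finset.sum_congr rfl fun u _ => ?_
        rw [Finset.sum_filter]
        split_ifs with hu
        · refine Finset.sum_congr rfl fun s _ => ?_
          by_cases hs : ∀ p, s p ∣ d p.1.1 ∧ s p ∣ e p.1.2
          · rw [if_pos hs, if_pos]
            exact ⟨⟨fun i => (hu i).1, fun p => (hs p).1⟩, fun j => (hu j).2, fun p => (hs p).2⟩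
          · rw [if_neg hs, if_neg]
            rintro ⟨⟨-, h1⟩, -, h2⟩
            exact hs fun p => ⟨h1 p, h2 p⟩
        · symm
          refine Finset.sum_eq_zero fun s _ => ?_
          rw [if_neg]
          rintro ⟨⟨h1, -⟩, h2, -⟩
          exact hu fun i => ⟨h1 i, h2 i⟩


/-- `Σ_{d good, RowCond} Λ_d/∏ψ(dᵢ) = S(A(u,s))`. [folklore] -/
theorem sum_ite_rowCond_eq (cf : (Fin k → ℕ) → ℝ) (u : Fin k → ℕ) (s : OffDiag k → ℕ) :
    ∑ d ∈ boxG k W B, (if RowCond u s d then cf d / ∏ i, ψ (d i) else 0) =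
      Ssum W B ψ cf (rowT u s) := by
  rw [Ssum, ← Finset.sum_filter]
  refine Finset.sum_congr ?_ fun _ _ => rfl
  ext d
  simp only [Finset.mem_filter, RowCond, rowT_dvd_iff]

/-- `Σ_{e good, ColCond} Λ_e/∏ψ(eᵢ) = S(B(u,s))`. [folklore] -/
theorem sum_ite_colCond_eq (cf : (Fin k → ℕ) → ℝ) (u : Fin k → ℕ) (s : OffDiag k → ℕ) :
    ∑ e ∈ boxG k W B, (if ColCond u s e then cf e / ∏ i, ψ (e i) else 0) =
      Ssum W B ψ cf (colT u s) := by
  rw [Ssum, ← Finset.sum_filter]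
  refine Finset.sum_congr ?_ fun _ _ => rfl
  ext e
  simp only [Finset.mem_filter, ColCond, colT_dvd_iff]

/-- **Rearrangement of the bilinear form** (Maynard (5.6)–(5.7) with the change of variables
(5.8), resp. (5.23)–(5.24)):
`Σ'_{d,e} Λ_dΛ_e/∏ψ([dᵢ,eᵢ]) = Σ_{u} Σ_{s} ∏ρ(uᵢ) ∏μ(s_{i,j}) S(A(u,s)) S(B(u,s))`.
[cite: MaynardAnnals2015, (5.6)–(5.8) and (5.23)–(5.24)] -/
theorem bilinear_rearrange (hψ : ψ.IsMultiplicative)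
    (hρψ : ∀ n ∈ G1 W B, ∑ u ∈ n.divisors, ρ u = ψ n) (hψpos : ∀ n ∈ G1 W B, 0 < ψ n)
    (cf : (Fin k → ℕ) → ℝ) :
    ∑ d ∈ boxG k W B, ∑ e ∈ boxG k W B,
        (if ∀ p : OffDiag k, (d p.1.1).Coprime (e p.1.2) then
          cf d * cf e / ∏ i, ψ (Nat.lcm (d i) (e i)) else 0) =
      ∑ u ∈ boxG k W B, ∑ s ∈ sboxG k W B,
        (∏ i, ρ (u i)) * (∏ p, ((μ (s p) : ℤ) : ℝ)) *
          (Ssum W B ψ cf (rowT u s) * Ssum W B ψ cf (colT u s)) := by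
  -- expand each term
  have hexp : ∑ d ∈ boxG k W B, ∑ e ∈ boxG k W B,
      (if ∀ p : OffDiag k, (d p.1.1).Coprime (e p.1.2) then
        cf d * cf e / ∏ i, ψ (Nat.lcm (d i) (e i)) else 0) =
      ∑ d ∈ boxG k W B, ∑ e ∈ boxG k W B, ∑ u ∈ boxG k W B, ∑ s ∈ sboxG k W B,
        if RowCond u s d ∧ ColCond u s e then
          (∏ i, ρ (u i)) * (∏ p, ((μ (s p) : ℤ) : ℝ)) * (cf d / ∏ i, ψ (d i)) * (cf e / ∏ i, ψ (e i))
        else 0 :=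
    Finset.sum_congr rfl fun d hd => Finset.sum_congr rfl fun e he =>
      term_expand hψ hρψ hψpos cf hd he
  rw [hexp]
  -- swap the order of summation: (d, e, u, s) → (u, s, d, e)
  have hswap : ∑ d ∈ boxG k W B, ∑ e ∈ boxG k W B, ∑ u ∈ boxG k W B, ∑ s ∈ sboxG k W B,
      (if RowCond u s d ∧ ColCond u s e then
        (∏ i, ρ (u i)) * (∏ p, ((μ (s p) : ℤ) : ℝ)) * (cf d / ∏ i, ψ (d i)) * (cf e / ∏ i, ψ (e i))
        else 0) =
      ∑ u ∈ boxG k W B, ∑ s ∈ sboxG k W B, ∑ d ∈ boxG k W B, ∑ e ∈ boxG k W B,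
      (if RowCond u s d ∧ ColCond u s e then
        (∏ i, ρ (u i)) * (∏ p, ((μ (s p) : ℤ) : ℝ)) * (cf d / ∏ i, ψ (d i)) * (cf e / ∏ i, ψ (e i))
        else 0) := by
    calc _ = ∑ d ∈ boxG k W B, ∑ u ∈ boxG k W B, ∑ e ∈ boxG k W B, ∑ s ∈ sboxG k W B,
          (if RowCond u s d ∧ ColCond u s e then
            (∏ i, ρ (u i)) * (∏ p, ((μ (s p) : ℤ) : ℝ)) * (cf d / ∏ i, ψ (d i)) *
              (cf e / ∏ i, ψ (e i)) else 0) :=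
          Finset.sum_congr rfl fun _ _ => Finset.sum_comm
      _ = ∑ u ∈ boxG k W B, ∑ d ∈ boxG k W B, ∑ e ∈ boxG k W B, ∑ s ∈ sboxG k W B,
          (if RowCond u s d ∧ ColCond u s e then
            (∏ i, ρ (u i)) * (∏ p, ((μ (s p) : ℤ) : ℝ)) * (cf d / ∏ i, ψ (d i)) *
              (cf e / ∏ i, ψ (e i)) else 0) := Finset.sum_comm
      _ = ∑ u ∈ boxG k W B, ∑ d ∈ boxG k W B, ∑ s ∈ sboxG k W B, ∑ e ∈ boxG k W B,
          (if RowCond u s d ∧ ColCond u s e then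
            (∏ i, ρ (u i)) * (∏ p, ((μ (s p) : ℤ) : ℝ)) * (cf d / ∏ i, ψ (d i)) *
              (cf e / ∏ i, ψ (e i)) else 0) :=
          Finset.sum_congr rfl fun _ _ => Finset.sum_congr rfl fun _ _ => Finset.sum_comm
      _ = _ := Finset.sum_congr rfl fun _ _ => Finset.sum_comm
  rw [hswap]
  refine Finset.sum_congr rfl fun u _ => Finset.sum_congr rfl fun s _ => ?_
  -- factor the inner double sum
  have hfac : ∀ d ∈ boxG k W B, ∀ e ∈ boxG k W B,
      (if RowCond u s d ∧ ColCond u s e then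
        (∏ i, ρ (u i)) * (∏ p, ((μ (s p) : ℤ) : ℝ)) * (cf d / ∏ i, ψ (d i)) * (cf e / ∏ i, ψ (e i))
        else 0) =
      (∏ i, ρ (u i)) * (∏ p, ((μ (s p) : ℤ) : ℝ)) *
        ((if RowCond u s d then cf d / ∏ i, ψ (d i) else 0) *
          (if ColCond u s e then cf e / ∏ i, ψ (e i) else 0)) := by
    intro d _ e _
    by_cases h1 : RowCond u s d <;> by_cases h2 : ColCond u s e <;> simp [h1, h2]
    ring
  rw [Finset.sum_congr rfl fun d hd => Finset.sum_congr rfl fun e he => hfac d hd e he]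
  simp_rw [← Finset.mul_sum]
  rw [← Finset.sum_mul, sum_ite_rowCond_eq, sum_ite_colCond_eq]


/-! #### The diagonal (`s = 1`) and the vanishing analysis for `s ≠ 1` -/

/-- The trivial family `s_{i,j} = 1`. [folklore] -/
def oneFam (k : ℕ) : OffDiag k → ℕ := fun _ => 1

/-- `s = 1` lies in the `s`-box as soon as `B ≥ 1`. [folklore] -/
theorem oneFam_mem_sboxG (hB : 1 ≤ B) : oneFam k ∈ sboxG k W B := by
  rw [sboxG, Fintype.mem_piFinset]
  intro p
  rw [mem_G1]
  exact ⟨⟨le_rfl, hB⟩, squarefree_one, Nat.coprime_one_left W⟩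

/-- An `lcm` over a finset of the constant `1` is `1`. [folklore] -/
theorem lcm_oneFam_eq (t : Finset (OffDiag k)) : t.lcm (oneFam k) = 1 :=
  Nat.dvd_one.1 (Finset.lcm_dvd_iff.2 fun _ _ => by simp [oneFam])

/-- `A(u, 1) = u`. [folklore] -/
theorem rowT_oneFam (u : Fin k → ℕ) : rowT u (oneFam k) = u := by
  funext i; simp [rowT, lcm_oneFam_eq]

/-- `B(u, 1) = u`. [folklore] -/
theorem colT_oneFam (u : Fin k → ℕ) : colT u (oneFam k) = u := by
  funext i; simp [colT, lcm_oneFam_eq]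

/-- `uᵢ ∣ Aᵢ`. [folklore] -/
theorem dvd_rowT (u : Fin k → ℕ) (s : OffDiag k → ℕ) (i : Fin k) : u i ∣ rowT u s i :=
  Nat.dvd_lcm_left _ _

/-- `uⱼ ∣ Bⱼ`. [folklore] -/
theorem dvd_colT (u : Fin k → ℕ) (s : OffDiag k → ℕ) (j : Fin k) : u j ∣ colT u s j :=
  Nat.dvd_lcm_left _ _

/-- `s_p ∣ A_{p.1}`. [folklore] -/
theorem dvd_rowT' (u : Fin k → ℕ) (s : OffDiag k → ℕ) (p : OffDiag k) : s p ∣ rowT u s p.1.1 := by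
  have h1 : s p ∣ (Finset.univ.filter fun q : OffDiag k => q.1.1 = p.1.1).lcm s :=
    Finset.dvd_lcm (Finset.mem_filter.2 ⟨Finset.mem_univ _, rfl⟩)
  exact h1.trans (Nat.dvd_lcm_right (u p.1.1) _)

/-- `s_p ∣ B_{p.2}`. [folklore] -/
theorem dvd_colT' (u : Fin k → ℕ) (s : OffDiag k → ℕ) (p : OffDiag k) : s p ∣ colT u s p.1.2 := by
  have h1 : s p ∣ (Finset.univ.filter fun q : OffDiag k => q.1.2 = p.1.2).lcm s :=
    Finset.dvd_lcm (Finset.mem_filter.2 ⟨Finset.mem_univ _, rfl⟩)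
  exact h1.trans (Nat.dvd_lcm_right (u p.1.2) _)

/-- **The vanishing analysis** ("terms with `s_{i,j}` not coprime to `u_i`, `u_j`, `s_{i,a}`,
`s_{b,j}` make no contribution", Maynard, proof of Lemma 5.1): if both `A(u,s)` and `B(u,s)`
are good then the whole family `(uᵢ)ᵢ, (s_p)_p` is pairwise coprime.
[cite: MaynardAnnals2015, proof of Lemma 5.1 (restrictions on s_{i,j})] -/
theorem coprime_of_isGood_rowT_colT {u : Fin k → ℕ} {s : OffDiag k → ℕ}
    (hA : IsGood W (rowT u s)) (hBc : IsGood W (colT u s)) :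
    (∀ i j, i ≠ j → (u i).Coprime (u j)) ∧ (∀ i p, (u i).Coprime (s p)) ∧
      ∀ p q : OffDiag k, p ≠ q → (s p).Coprime (s q) := by
  refine ⟨fun i j hij => ?_, fun i p => ?_, fun p q hpq => ?_⟩
  · exact Nat.Coprime.coprime_dvd_left (dvd_rowT u s i)
      (Nat.Coprime.coprime_dvd_right (dvd_rowT u s j) (hA.coprime_of_ne hij))
  · by_cases h : i = p.1.1
    · -- use the columns: `i = p.1 ≠ p.2`
      have hne : i ≠ p.1.2 := h ▸ p.2
      exact Nat.Coprime.coprime_dvd_left (dvd_colT u s i)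
        (Nat.Coprime.coprime_dvd_right (dvd_colT' u s p) (hBc.coprime_of_ne hne))
    · exact Nat.Coprime.coprime_dvd_left (dvd_rowT u s i)
        (Nat.Coprime.coprime_dvd_right (dvd_rowT' u s p) (hA.coprime_of_ne h))
  · by_cases h : p.1.1 = q.1.1
    · have hne : p.1.2 ≠ q.1.2 := by
        intro h2
        exact hpq (Subtype.ext (Prod.ext h h2))
      exact Nat.Coprime.coprime_dvd_left (dvd_colT' u s p)
        (Nat.Coprime.coprime_dvd_right (dvd_colT' u s q) (hBc.coprime_of_ne hne))
    · exact Nat.Coprime.coprime_dvd_left (dvd_rowT' u s p)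
        (Nat.Coprime.coprime_dvd_right (dvd_rowT' u s q) (hA.coprime_of_ne h))

/-- Under pairwise coprimality, `Aᵢ = uᵢ ∏_{p.1 = i} s_p`. [folklore] -/
theorem rowT_eq_mul_prod {u : Fin k → ℕ} {s : OffDiag k → ℕ}
    (h2 : ∀ i p, (u i).Coprime (s p)) (h3 : ∀ p q : OffDiag k, p ≠ q → (s p).Coprime (s q))
    (i : Fin k) :
    rowT u s i = u i * ∏ p ∈ Finset.univ.filter (fun p : OffDiag k => p.1.1 = i), s p := by
  rw [rowT, Finset.lcm_eq_prod (fun x _ y _ hxy => h3 x y hxy)]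
  exact (Nat.Coprime.prod_right fun p _ => h2 i p).lcm_eq_mul

/-- Under pairwise coprimality, `Bⱼ = uⱼ ∏_{p.2 = j} s_p`. [folklore] -/
theorem colT_eq_mul_prod {u : Fin k → ℕ} {s : OffDiag k → ℕ}
    (h2 : ∀ i p, (u i).Coprime (s p)) (h3 : ∀ p q : OffDiag k, p ≠ q → (s p).Coprime (s q))
    (j : Fin k) :
    colT u s j = u j * ∏ p ∈ Finset.univ.filter (fun p : OffDiag k => p.1.2 = j), s p := by
  rw [colT, Finset.lcm_eq_prod (fun x _ y _ hxy => h3 x y hxy)]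
  exact (Nat.Coprime.prod_right fun p _ => h2 j p).lcm_eq_mul

/-- Under pairwise coprimality, `∏ᵢ ρ(Aᵢ) = ∏ᵢ ρ(uᵢ) · ∏_p ρ(s_p)` for multiplicative `ρ`. [folklore] -/
theorem prod_rho_rowT_eq (hρ : ρ.IsMultiplicative) {u : Fin k → ℕ} {s : OffDiag k → ℕ}
    (h2 : ∀ i p, (u i).Coprime (s p)) (h3 : ∀ p q : OffDiag k, p ≠ q → (s p).Coprime (s q)) :
    ∏ i, ρ (rowT u s i) = (∏ i, ρ (u i)) * ∏ p, ρ (s p) := by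
  have : ∀ i, ρ (rowT u s i) =
      ρ (u i) * ∏ p ∈ Finset.univ.filter (fun p : OffDiag k => p.1.1 = i), ρ (s p) := by
    intro i
    rw [rowT_eq_mul_prod h2 h3 i,
      hρ.map_mul_of_coprime (Nat.Coprime.prod_right fun p _ => h2 i p),
      hρ.map_prod s _ fun x _ y _ hxy => h3 x y hxy]
  simp_rw [this]
  rw [Finset.prod_mul_distrib, Finset.prod_fiberwise (s := Finset.univ) (g := fun p : OffDiag k => p.1.1)
    (f := fun p => ρ (s p))]

/-- Under pairwise coprimality, `∏ⱼ ρ(Bⱼ) = ∏ⱼ ρ(uⱼ) · ∏_p ρ(s_p)` for multiplicative `ρ`. [folklore] -/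
theorem prod_rho_colT_eq (hρ : ρ.IsMultiplicative) {u : Fin k → ℕ} {s : OffDiag k → ℕ}
    (h2 : ∀ i p, (u i).Coprime (s p)) (h3 : ∀ p q : OffDiag k, p ≠ q → (s p).Coprime (s q)) :
    ∏ j, ρ (colT u s j) = (∏ j, ρ (u j)) * ∏ p, ρ (s p) := by
  have : ∀ j, ρ (colT u s j) =
      ρ (u j) * ∏ p ∈ Finset.univ.filter (fun p : OffDiag k => p.1.2 = j), ρ (s p) := by
    intro j
    rw [colT_eq_mul_prod h2 h3 j,
      hρ.map_mul_of_coprime (Nat.Coprime.prod_right fun p _ => h2 j p),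
      hρ.map_prod s _ fun x _ y _ hxy => h3 x y hxy]
  simp_rw [this]
  rw [Finset.prod_mul_distrib, Finset.prod_fiberwise (s := Finset.univ) (g := fun p : OffDiag k => p.1.2)
    (f := fun p => ρ (s p))]


/-- If `S(A) ≠ 0` then `A` is a good tuple of the box. [folklore] -/
theorem mem_boxG_of_Ssum_ne_zero (cf : (Fin k → ℕ) → ℝ) {A : Fin k → ℕ}
    (h : Ssum W B ψ cf A ≠ 0) : A ∈ boxG k W B := by
  obtain ⟨d, hd, -⟩ := Finset.exists_ne_zero_of_sum_ne_zero h
  rw [Finset.mem_filter] at hd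
  obtain ⟨hd, hA⟩ := hd
  rw [mem_boxG, mem_box] at hd ⊢
  refine ⟨fun i => ⟨Nat.pos_of_ne_zero fun h0 => ?_, (Nat.le_of_dvd (hd.1 i).1 (hA i)).trans (hd.1 i).2⟩,
    hd.2.of_dvd hA⟩
  have := hA i
  rw [h0, zero_dvd_iff] at this
  exact absurd this (by have := (hd.1 i).1; omega)

/-- `|S(A)| ≤ Y_max / ∏ ρ(Aᵢ)` for good `A` (`|μ(Aᵢ)| = 1`, `ρ(Aᵢ) > 0`). [folklore] -/
theorem abs_Ssum_le (hρpos : ∀ n ∈ G1 W B, 0 < ρ n) (cf : (Fin k → ℕ) → ℝ) {Ymax : ℝ}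
    (hY : ∀ A ∈ boxG k W B, |Yv W B ψ ρ cf A| ≤ Ymax) {A : Fin k → ℕ} (hA : A ∈ boxG k W B) :
    |Ssum W B ψ cf A| ≤ Ymax / ∏ i, ρ (A i) := by
  have hAG := apply_mem_G1_of_mem_boxG hA
  have hρA : 0 < ∏ i, ρ (A i) := Finset.prod_pos fun i _ => hρpos _ (hAG i)
  have hμ : |∏ i, ((μ (A i) : ℤ) : ℝ)| = 1 := by
    rw [Finset.abs_prod]
    refine Finset.prod_eq_one fun i _ => ?_
    have := ArithmeticFunction.abs_moebius_eq_one_of_squarefree (mem_G1.1 (hAG i)).2.1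
    rw [← Int.cast_abs]; exact_mod_cast this
  have key := hY A hA
  rw [Yv, Finset.prod_mul_distrib, abs_mul, abs_mul, hμ, one_mul, abs_of_pos hρA] at key
  rw [le_div_iff₀ hρA, mul_comm]
  exact key

/-- **The bound for one off-diagonal term**: for good `u` and any family `s` of good scalars,
`|∏ρ(uᵢ) ∏μ(s_p) S(A(u,s)) S(B(u,s))| ≤ Y_max² / (∏ρ(uᵢ) ∏ρ(s_p)²)` — trivially if one of the
`S` vanishes, and by the vanishing analysis (pairwise coprimality, `ρ(Aᵢ) = ρ(uᵢ)∏ρ(s_{i,·})`)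
otherwise. This is the summand of Maynard's (5.13) (resp. (5.25)).
[cite: MaynardAnnals2015, (5.13) and (5.25)] -/
theorem abs_offdiag_term_le (hρ : ρ.IsMultiplicative) (hρpos : ∀ n ∈ G1 W B, 0 < ρ n)
    (cf : (Fin k → ℕ) → ℝ) {Ymax : ℝ} (hY : ∀ A ∈ boxG k W B, |Yv W B ψ ρ cf A| ≤ Ymax)
    {u : Fin k → ℕ} (hu : u ∈ boxG k W B) {s : OffDiag k → ℕ} (hs : s ∈ sboxG k W B) :
    |(∏ i, ρ (u i)) * (∏ p, ((μ (s p) : ℤ) : ℝ)) *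
        (Ssum W B ψ cf (rowT u s) * Ssum W B ψ cf (colT u s))| ≤
      Ymax ^ 2 / ((∏ i, ρ (u i)) * ∏ p, ρ (s p) ^ 2) := by
  have huG := apply_mem_G1_of_mem_boxG hu
  have hsG : ∀ p, s p ∈ G1 W B := fun p => Fintype.mem_piFinset.1 hs p
  have hρu : 0 < ∏ i, ρ (u i) := Finset.prod_pos fun i _ => hρpos _ (huG i)
  have hρs : 0 < ∏ p, ρ (s p) := Finset.prod_pos fun p _ => hρpos _ (hsG p)
  have hYmax : 0 ≤ Ymax := le_trans (abs_nonneg _) (hY u hu)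
  have hRHS : 0 ≤ Ymax ^ 2 / ((∏ i, ρ (u i)) * ∏ p, ρ (s p) ^ 2) := by positivity
  by_cases h0 : Ssum W B ψ cf (rowT u s) = 0 ∨ Ssum W B ψ cf (colT u s) = 0
  · rcases h0 with h0 | h0 <;> simp [h0, hRHS]
  push Not at h0
  have hA := mem_boxG_of_Ssum_ne_zero cf h0.1
  have hBc := mem_boxG_of_Ssum_ne_zero cf h0.2
  obtain ⟨-, h2, h3⟩ := coprime_of_isGood_rowT_colT (mem_boxG.1 hA).2 (mem_boxG.1 hBc).2
  have eA := prod_rho_rowT_eq hρ h2 h3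
  have eB := prod_rho_colT_eq hρ h2 h3
  have bA := abs_Ssum_le hρpos cf hY hA
  have bB := abs_Ssum_le hρpos cf hY hBc
  rw [eA] at bA
  rw [eB] at bB
  have hμ : |∏ p, ((μ (s p) : ℤ) : ℝ)| ≤ 1 := by
    rw [Finset.abs_prod]
    refine Finset.prod_le_one (fun _ _ => abs_nonneg _) fun p _ => ?_
    have := ArithmeticFunction.abs_moebius_le_one (n := s p)
    rw [← Int.cast_abs]; exact_mod_cast this
  have hprod : 0 < (∏ i, ρ (u i)) * ∏ p, ρ (s p) := mul_pos hρu hρs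
  calc |(∏ i, ρ (u i)) * (∏ p, ((μ (s p) : ℤ) : ℝ)) *
          (Ssum W B ψ cf (rowT u s) * Ssum W B ψ cf (colT u s))|
      = (∏ i, ρ (u i)) * |∏ p, ((μ (s p) : ℤ) : ℝ)| *
          (|Ssum W B ψ cf (rowT u s)| * |Ssum W B ψ cf (colT u s)|) := by
        rw [abs_mul, abs_mul, abs_mul, abs_of_pos hρu]
    _ ≤ (∏ i, ρ (u i)) * 1 *
          ((Ymax / ((∏ i, ρ (u i)) * ∏ p, ρ (s p))) * (Ymax / ((∏ i, ρ (u i)) * ∏ p, ρ (s p)))) := by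
        refine mul_le_mul (mul_le_mul_of_nonneg_left hμ hρu.le)
          (mul_le_mul bA bB (abs_nonneg _) (le_trans (abs_nonneg _) bA))
          (mul_nonneg (abs_nonneg _) (abs_nonneg _)) (by rw [mul_one]; exact hρu.le)
    _ = Ymax ^ 2 / ((∏ i, ρ (u i)) * ∏ p, ρ (s p) ^ 2) := by
        rw [Finset.prod_pow]
        have h1 : (∏ i, ρ (u i)) ≠ 0 := hρu.ne'
        have h2 : (∏ p, ρ (s p)) ≠ 0 := hρs.ne'
        field_simp

/-- **The diagonal term**: for good `u`, the `s = 1` summand is `Y_u² / ∏ρ(uᵢ)`.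
[cite: MaynardAnnals2015, (5.14) and (5.26)] -/
theorem diag_term_eq (hρpos : ∀ n ∈ G1 W B, 0 < ρ n) (cf : (Fin k → ℕ) → ℝ) {u : Fin k → ℕ}
    (hu : u ∈ boxG k W B) :
    (∏ i, ρ (u i)) * (∏ p, ((μ (oneFam k p) : ℤ) : ℝ)) *
        (Ssum W B ψ cf (rowT u (oneFam k)) * Ssum W B ψ cf (colT u (oneFam k))) =
      Yv W B ψ ρ cf u ^ 2 / ∏ i, ρ (u i) := by
  have huG := apply_mem_G1_of_mem_boxG hu
  have hρu : 0 < ∏ i, ρ (u i) := Finset.prod_pos fun i _ => hρpos _ (huG i)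
  have hμ2 : (∏ i, ((μ (u i) : ℤ) : ℝ)) ^ 2 = 1 := by
    rw [← Finset.prod_pow]
    refine Finset.prod_eq_one fun i _ => ?_
    have := ArithmeticFunction.moebius_sq_eq_one_of_squarefree (mem_G1.1 (huG i)).2.1
    exact_mod_cast this
  rw [rowT_oneFam, colT_oneFam]
  simp only [oneFam, ArithmeticFunction.moebius_apply_one, Int.cast_one, Finset.prod_const_one,
    mul_one]
  rw [Yv, Finset.prod_mul_distrib, eq_div_iff hρu.ne']
  calc (∏ i, ρ (u i)) * (Ssum W B ψ cf u * Ssum W B ψ cf u) * ∏ i, ρ (u i)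
      = (∏ i, ((μ (u i) : ℤ) : ℝ)) ^ 2 * (∏ i, ρ (u i)) ^ 2 * Ssum W B ψ cf u ^ 2 := by
        rw [hμ2]; ring
    _ = _ := by ring

/-- **The bilinear form: diagonal plus error** (Maynard (5.14)/(5.26)): with
`L_ρ = Σ_{u ≤ B good} 1/ρ(u)`, `Z_ρ = Σ_{s ≤ B good} 1/ρ(s)²` and `K = #OffDiag = k² − k`,
`|Σ'_{d,e} Λ_dΛ_e/∏ψ([dᵢ,eᵢ]) − Σ_u Y_u²/∏ρ(uᵢ)| ≤ Y_max² L_ρ^k (Z_ρ^K − 1)`.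
[cite: MaynardAnnals2015, Lemma 5.1 (5.13)–(5.14) and Lemma 5.2 (5.25)–(5.26)] -/
theorem abs_bilinear_sub_diag_le (hψ : ψ.IsMultiplicative) (hρ : ρ.IsMultiplicative)
    (hρψ : ∀ n ∈ G1 W B, ∑ u ∈ n.divisors, ρ u = ψ n) (hψpos : ∀ n ∈ G1 W B, 0 < ψ n)
    (hρpos : ∀ n ∈ G1 W B, 0 < ρ n) (hB : 1 ≤ B) (cf : (Fin k → ℕ) → ℝ) {Ymax : ℝ}
    (hY : ∀ A ∈ boxG k W B, |Yv W B ψ ρ cf A| ≤ Ymax) :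
    |∑ d ∈ boxG k W B, ∑ e ∈ boxG k W B,
        (if ∀ p : OffDiag k, (d p.1.1).Coprime (e p.1.2) then
          cf d * cf e / ∏ i, ψ (Nat.lcm (d i) (e i)) else 0) -
        ∑ u ∈ boxG k W B, Yv W B ψ ρ cf u ^ 2 / ∏ i, ρ (u i)| ≤
      Ymax ^ 2 * (∑ n ∈ G1 W B, 1 / ρ n) ^ k *
        ((∑ n ∈ G1 W B, 1 / ρ n ^ 2) ^ Fintype.card (OffDiag k) - 1) := by
  rw [bilinear_rearrange hψ hρψ hψpos cf]
  set F : (Fin k → ℕ) → (OffDiag k → ℕ) → ℝ := fun u s =>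
    (∏ i, ρ (u i)) * (∏ p, ((μ (s p) : ℤ) : ℝ)) *
      (Ssum W B ψ cf (rowT u s) * Ssum W B ψ cf (colT u s)) with hF
  have h1 : ∀ u ∈ boxG k W B, ∑ s ∈ sboxG k W B, F u s =
      Yv W B ψ ρ cf u ^ 2 / ∏ i, ρ (u i) + ∑ s ∈ (sboxG k W B).erase (oneFam k), F u s := by
    intro u hu
    rw [← Finset.add_sum_erase _ _ (oneFam_mem_sboxG hB), hF]
    dsimp only
    rw [diag_term_eq hρpos cf hu]
  rw [Finset.sum_congr rfl h1, Finset.sum_add_distrib, add_sub_cancel_left]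
  -- bound the off-diagonal part
  have hYmax2 : 0 ≤ Ymax ^ 2 := sq_nonneg _
  calc |∑ u ∈ boxG k W B, ∑ s ∈ (sboxG k W B).erase (oneFam k), F u s|
      ≤ ∑ u ∈ boxG k W B, ∑ s ∈ (sboxG k W B).erase (oneFam k), |F u s| := by
        refine (Finset.abs_sum_le_sum_abs _ _).trans (Finset.sum_le_sum fun u _ => ?_)
        exact Finset.abs_sum_le_sum_abs _ _
    _ ≤ ∑ u ∈ boxG k W B, ∑ s ∈ (sboxG k W B).erase (oneFam k),
          Ymax ^ 2 * ((1 / ∏ i, ρ (u i)) * ∏ p, 1 / ρ (s p) ^ 2) := by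
        refine Finset.sum_le_sum fun u hu => Finset.sum_le_sum fun s hs => ?_
        have hs' := Finset.mem_of_mem_erase hs
        refine (abs_offdiag_term_le hρ hρpos cf hY hu hs').trans (le_of_eq ?_)
        rw [Finset.prod_div_distrib, Finset.prod_const_one]
        field_simp
    _ = Ymax ^ 2 * ((∑ u ∈ boxG k W B, 1 / ∏ i, ρ (u i)) *
          ∑ s ∈ (sboxG k W B).erase (oneFam k), ∏ p, 1 / ρ (s p) ^ 2) := by
        rw [Finset.sum_mul_sum, Finset.mul_sum]
        refine Finset.sum_congr rfl fun u _ => ?_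
        rw [Finset.mul_sum]
    _ ≤ Ymax ^ 2 * ((∑ n ∈ G1 W B, 1 / ρ n) ^ k *
          ((∑ n ∈ G1 W B, 1 / ρ n ^ 2) ^ Fintype.card (OffDiag k) - 1)) := by
        refine mul_le_mul_of_nonneg_left ?_ hYmax2
        have hL0 : ∀ u ∈ boxG k W B, 0 ≤ 1 / ∏ i, ρ (u i) := fun u hu =>
          div_nonneg zero_le_one (Finset.prod_nonneg fun i _ =>
            (hρpos _ (apply_mem_G1_of_mem_boxG hu i)).le)
        have hZ0 : ∀ s ∈ (sboxG k W B).erase (oneFam k), 0 ≤ ∏ p, 1 / ρ (s p) ^ 2 :=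
          fun s _ => Finset.prod_nonneg fun p _ => div_nonneg zero_le_one (sq_nonneg _)
        have hG0 : 0 ≤ ∑ n ∈ G1 W B, 1 / ρ n :=
          Finset.sum_nonneg fun n hn => div_nonneg zero_le_one (hρpos n hn).le
        refine mul_le_mul ?_ ?_ (Finset.sum_nonneg hZ0) (pow_nonneg hG0 k)
        · -- `Σ_{u good} 1/∏ρ(uᵢ) ≤ (Σ_{n ∈ G1} 1/ρ(n))^k`
          calc ∑ u ∈ boxG k W B, 1 / ∏ i, ρ (u i)
              = ∑ u ∈ boxG k W B, ∏ i, 1 / ρ (u i) := by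
                refine Finset.sum_congr rfl fun u _ => ?_
                rw [one_div, ← Finset.prod_inv_distrib]
                exact Finset.prod_congr rfl fun i _ => (one_div _).symm
            _ ≤ ∑ u ∈ Fintype.piFinset (fun _ : Fin k => G1 W B), ∏ i, 1 / ρ (u i) := by
                refine Finset.sum_le_sum_of_subset_of_nonneg (boxG_subset_piFinset k W B) ?_
                intro u hu _
                exact Finset.prod_nonneg fun i _ =>
                  div_nonneg zero_le_one (hρpos _ (Fintype.mem_piFinset.1 hu i)).le
            _ = (∑ n ∈ G1 W B, 1 / ρ n) ^ k := by
                rw [← Finset.prod_univ_sum (fun _ : Fin k => G1 W B) (fun _ n => 1 / ρ n),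
                  Finset.prod_const, Finset.card_univ, Fintype.card_fin]
        · -- `Σ_{s ≠ 1} ∏ 1/ρ(s_p)² = Z^K − 1`
          rw [Finset.sum_erase_eq_sub (oneFam_mem_sboxG hB)]
          have hone : ∏ p : OffDiag k, 1 / ρ (oneFam k p) ^ 2 = 1 := by
            simp [oneFam, hρ.map_one]
          rw [hone, sboxG, ← Finset.prod_univ_sum (fun _ : OffDiag k => G1 W B) (fun _ n => 1 / ρ n ^ 2),
            Finset.prod_const, Finset.card_univ]
    _ = _ := by ring


/-- If the coefficients are supported on `d` with `d_m = 1`, the off-diagonal term at `(u, s)`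
vanishes unless `u_m = 1` (`S(A(u,s)) ≠ 0` forces `A(u,s)_m = 1`, and `u_m ∣ A(u,s)_m`). [folklore] -/
theorem Ssum_rowT_eq_zero_of_ne (cf : (Fin k → ℕ) → ℝ) {m : Fin k}
    (hm : ∀ d, cf d ≠ 0 → d m = 1) {u : Fin k → ℕ} (hum : u m ≠ 1) (s : OffDiag k → ℕ) :
    Ssum W B ψ cf (rowT u s) = 0 := by
  refine Finset.sum_eq_zero fun d hd => ?_
  rw [Finset.mem_filter] at hd
  have : cf d = 0 := by
    by_contra h
    have hdm := hm d h
    have : u m ∣ 1 := hdm ▸ (dvd_rowT u s m).trans (hd.2 m)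
    exact hum (Nat.dvd_one.1 this)
  rw [this, zero_div]

/-- **The bilinear form: diagonal plus error, slot version** (for Maynard's Lemma 5.2, where the
coefficients `λ_d [d_m = 1]` are supported on `d_m = 1` and hence only `u` with `u_m = 1` contribute):
`|Σ'_{d,e} Λ_dΛ_e/∏ψ([dᵢ,eᵢ]) − Σ_u Y_u²/∏ρ(uᵢ)| ≤ Y_max² L_ρ^{k−1} (Z_ρ^K − 1)` — the printed exponent
`k − 1` of (5.25). [cite: MaynardAnnals2015, Lemma 5.2 (5.25)–(5.26)] -/
theorem abs_bilinear_sub_diag_le_slot (hψ : ψ.IsMultiplicative) (hρ : ρ.IsMultiplicative)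
    (hρψ : ∀ n ∈ G1 W B, ∑ u ∈ n.divisors, ρ u = ψ n) (hψpos : ∀ n ∈ G1 W B, 0 < ψ n)
    (hρpos : ∀ n ∈ G1 W B, 0 < ρ n) (hB : 1 ≤ B) (cf : (Fin k → ℕ) → ℝ) {m : Fin k}
    (hm : ∀ d, cf d ≠ 0 → d m = 1) {Ymax : ℝ}
    (hY : ∀ A ∈ boxG k W B, |Yv W B ψ ρ cf A| ≤ Ymax) :
    |∑ d ∈ boxG k W B, ∑ e ∈ boxG k W B,
        (if ∀ p : OffDiag k, (d p.1.1).Coprime (e p.1.2) then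
          cf d * cf e / ∏ i, ψ (Nat.lcm (d i) (e i)) else 0) -
        ∑ u ∈ boxG k W B, Yv W B ψ ρ cf u ^ 2 / ∏ i, ρ (u i)| ≤
      Ymax ^ 2 * (∑ n ∈ G1 W B, 1 / ρ n) ^ (k - 1) *
        ((∑ n ∈ G1 W B, 1 / ρ n ^ 2) ^ Fintype.card (OffDiag k) - 1) := by
  rw [bilinear_rearrange hψ hρψ hψpos cf]
  set F : (Fin k → ℕ) → (OffDiag k → ℕ) → ℝ := fun u s =>
    (∏ i, ρ (u i)) * (∏ p, ((μ (s p) : ℤ) : ℝ)) *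
      (Ssum W B ψ cf (rowT u s) * Ssum W B ψ cf (colT u s)) with hF
  have h1 : ∀ u ∈ boxG k W B, ∑ s ∈ sboxG k W B, F u s =
      Yv W B ψ ρ cf u ^ 2 / ∏ i, ρ (u i) + ∑ s ∈ (sboxG k W B).erase (oneFam k), F u s := by
    intro u hu
    rw [← Finset.add_sum_erase _ _ (oneFam_mem_sboxG hB), hF]
    dsimp only
    rw [diag_term_eq hρpos cf hu]
  rw [Finset.sum_congr rfl h1, Finset.sum_add_distrib, add_sub_cancel_left]
  -- the `u` with `u_m ≠ 1` do not contribute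
  have hvan : ∀ u ∈ boxG k W B, u m ≠ 1 → ∑ s ∈ (sboxG k W B).erase (oneFam k), F u s = 0 := by
    intro u _ hum
    refine Finset.sum_eq_zero fun s _ => ?_
    simp only [hF, Ssum_rowT_eq_zero_of_ne cf hm hum s, zero_mul, mul_zero]
  rw [← Finset.sum_filter_of_ne (p := fun u => u m = 1) (fun u hu hne => by
    by_contra h; exact hne (hvan u hu h))]
  have hYmax2 : 0 ≤ Ymax ^ 2 := sq_nonneg _
  have hρ1 : ρ 1 = 1 := hρ.map_one
  calc |∑ u ∈ (boxG k W B).filter (fun u => u m = 1), ∑ s ∈ (sboxG k W B).erase (oneFam k), F u s|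
      ≤ ∑ u ∈ (boxG k W B).filter (fun u => u m = 1),
          ∑ s ∈ (sboxG k W B).erase (oneFam k), |F u s| := by
        refine (Finset.abs_sum_le_sum_abs _ _).trans (Finset.sum_le_sum fun u _ => ?_)
        exact Finset.abs_sum_le_sum_abs _ _
    _ ≤ ∑ u ∈ (boxG k W B).filter (fun u => u m = 1), ∑ s ∈ (sboxG k W B).erase (oneFam k),
          Ymax ^ 2 * ((1 / ∏ i, ρ (u i)) * ∏ p, 1 / ρ (s p) ^ 2) := by
        refine Finset.sum_le_sum fun u hu => Finset.sum_le_sum fun s hs => ?_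
        have hs' := Finset.mem_of_mem_erase hs
        have hu' := (Finset.mem_filter.1 hu).1
        refine (abs_offdiag_term_le hρ hρpos cf hY hu' hs').trans (le_of_eq ?_)
        rw [Finset.prod_div_distrib, Finset.prod_const_one]
        field_simp
    _ = Ymax ^ 2 * ((∑ u ∈ (boxG k W B).filter (fun u => u m = 1), 1 / ∏ i, ρ (u i)) *
          ∑ s ∈ (sboxG k W B).erase (oneFam k), ∏ p, 1 / ρ (s p) ^ 2) := by
        rw [Finset.sum_mul_sum, Finset.mul_sum]
        refine Finset.sum_congr rfl fun u _ => ?_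
        rw [Finset.mul_sum]
    _ ≤ Ymax ^ 2 * ((∑ n ∈ G1 W B, 1 / ρ n) ^ (k - 1) *
          ((∑ n ∈ G1 W B, 1 / ρ n ^ 2) ^ Fintype.card (OffDiag k) - 1)) := by
        refine mul_le_mul_of_nonneg_left ?_ hYmax2
        have hZ0 : ∀ s ∈ (sboxG k W B).erase (oneFam k), 0 ≤ ∏ p, 1 / ρ (s p) ^ 2 :=
          fun s _ => Finset.prod_nonneg fun p _ => div_nonneg zero_le_one (sq_nonneg _)
        have hG0 : 0 ≤ ∑ n ∈ G1 W B, 1 / ρ n :=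
          Finset.sum_nonneg fun n hn => div_nonneg zero_le_one (hρpos n hn).le
        refine mul_le_mul ?_ ?_ (Finset.sum_nonneg hZ0) (pow_nonneg hG0 _)
        · -- `Σ_{u good, u_m = 1} 1/∏ρ(uᵢ) ≤ (Σ_{n ∈ G1} 1/ρ(n))^{k-1}`
          calc ∑ u ∈ (boxG k W B).filter (fun u => u m = 1), 1 / ∏ i, ρ (u i)
              = ∑ u ∈ (boxG k W B).filter (fun u => u m = 1), ∏ i, 1 / ρ (u i) := by
                refine Finset.sum_congr rfl fun u _ => ?_
                rw [one_div, ← Finset.prod_inv_distrib]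
                exact Finset.prod_congr rfl fun i _ => (one_div _).symm
            _ ≤ ∑ u ∈ Fintype.piFinset (fun i : Fin k => if i = m then ({1} : Finset ℕ) else G1 W B),
                  ∏ i, 1 / ρ (u i) := by
                refine Finset.sum_le_sum_of_subset_of_nonneg (fun u hu => ?_) ?_
                · rw [Finset.mem_filter] at hu
                  rw [Fintype.mem_piFinset]
                  intro i
                  by_cases hi : i = m
                  · subst hi; rw [if_pos rfl, Finset.mem_singleton]; exact hu.2
                  · rw [if_neg hi]; exact apply_mem_G1_of_mem_boxG hu.1 i
                · intro u hu _
                  rw [Fintype.mem_piFinset] at hu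
                  refine Finset.prod_nonneg fun i _ => div_nonneg zero_le_one ?_
                  have := hu i
                  by_cases hi : i = m
                  · subst hi; rw [if_pos rfl, Finset.mem_singleton] at this; rw [this, hρ1]; exact zero_le_one
                  · rw [if_neg hi] at this; exact (hρpos _ this).le
            _ = ∏ i : Fin k, ∑ n ∈ (if i = m then ({1} : Finset ℕ) else G1 W B), 1 / ρ n := by
                rw [Finset.prod_univ_sum]
            _ = (∑ n ∈ G1 W B, 1 / ρ n) ^ (k - 1) := by
                rw [← Finset.mul_prod_erase _ _ (Finset.mem_univ m), if_pos rfl, Finset.sum_singleton,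
                  hρ1, div_one, one_mul]
                rw [Finset.prod_congr rfl fun i hi => by rw [if_neg (Finset.mem_erase.1 hi).1],
                  Finset.prod_const, Finset.card_erase_of_mem (Finset.mem_univ m), Finset.card_univ,
                  Fintype.card_fin]
        · rw [Finset.sum_erase_eq_sub (oneFam_mem_sboxG hB)]
          have hone : ∏ p : OffDiag k, 1 / ρ (oneFam k p) ^ 2 = 1 := by
            simp [oneFam, hρ1]
          rw [hone, sboxG, ← Finset.prod_univ_sum (fun _ : OffDiag k => G1 W B) (fun _ n => 1 / ρ n ^ 2),
            Finset.prod_const, Finset.card_univ]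
    _ = _ := by ring

end Hyps

/-! ### The two instances: `(ψ, ρ) = (id, φ)` for `S₁`, `(ψ, ρ) = (φ, g)` for `S₂^{(m)}` -/

/-- Euler's `φ` as a real arithmetic function. [folklore] -/
noncomputable def totAF : ArithmeticFunction ℝ := ⟨fun n => (n.totient : ℝ), by simp⟩

/-- Unfolding `totAF`. [folklore] -/
theorem totAF_apply (n : ℕ) : totAF n = (n.totient : ℝ) := rfl

/-- `φ` is multiplicative. [folklore] -/
theorem isMultiplicative_totAF : totAF.IsMultiplicative :=
  ⟨by simp [totAF_apply], fun h => by simp [totAF_apply, Nat.totient_mul h]⟩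

/-- `φ(n) > 0` for `n ≥ 1`. [folklore] -/
theorem totAF_pos {n : ℕ} (hn : 0 < n) : 0 < totAF n := by
  rw [totAF_apply]; exact_mod_cast Nat.totient_pos.2 hn

/-- The identity function as a real arithmetic function. [folklore] -/
noncomputable def idAF : ArithmeticFunction ℝ := ⟨fun n => (n : ℝ), by simp⟩

/-- Unfolding `idAF`. [folklore] -/
theorem idAF_apply (n : ℕ) : idAF n = (n : ℝ) := rfl

/-- `id` is multiplicative. [folklore] -/
theorem isMultiplicative_idAF : idAF.IsMultiplicative :=
  ⟨by simp [idAF_apply], fun _ => by simp [idAF_apply]⟩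

/-- Maynard's `g`: the multiplicative function with `g(p) = p − 2`, here as `n ↦ ∏_{p ∣ n} (p − 2)`
(it is only ever evaluated at squarefree `n`). [cite: MaynardAnnals2015, Lemma 5.2 (definition of g)] -/
noncomputable def gAF : ArithmeticFunction ℝ := ArithmeticFunction.prodPrimeFactors fun p => (p : ℝ) - 2

/-- `g` is multiplicative. [folklore] -/
theorem isMultiplicative_gAF : gAF.IsMultiplicative :=
  ArithmeticFunction.IsMultiplicative.prodPrimeFactors _

/-- `g(n) = ∏_{p ∣ n} (p − 2)` for `n ≥ 1`. [folklore] -/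
theorem gAF_apply {n : ℕ} (hn : n ≠ 0) : gAF n = ∏ p ∈ n.primeFactors, ((p : ℝ) - 2) := by
  rw [gAF, ArithmeticFunction.prodPrimeFactors_apply hn]

/-- `Σ_{u ∣ n} φ(u) = n`. [folklore] -/
theorem sum_divisors_totAF (n : ℕ) : ∑ u ∈ n.divisors, totAF u = idAF n := by
  simp only [totAF_apply, idAF_apply]
  exact_mod_cast Nat.sum_totient n

/-- `Σ_{u ∣ n} g(u) = φ(n)` for squarefree `n` (`∏_{p∣n}(1 + (p − 2)) = ∏_{p∣n}(p − 1)`).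
[cite: MaynardAnnals2015, (5.22)] -/
theorem sum_divisors_gAF {n : ℕ} (hn : Squarefree n) : ∑ u ∈ n.divisors, gAF u = totAF n := by
  rw [← isMultiplicative_gAF.prodPrimeFactors_one_add_of_squarefree hn,
    ← isMultiplicative_totAF.prod_primeFactors hn]
  refine Finset.prod_congr rfl fun p hp => ?_
  have hpp := Nat.prime_of_mem_primeFactors hp
  rw [gAF_apply hpp.ne_zero, hpp.primeFactors, Finset.prod_singleton, totAF_apply,
    Nat.totient_prime hpp, Nat.cast_sub hpp.one_lt.le]
  push_cast; ring

/-- `g(n) > 0` for squarefree... in fact for all `n ≥ 1` all of whose prime factors are `≥ 3`, in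
particular for `n` coprime to an even `W`. [folklore] -/
theorem gAF_pos {W n : ℕ} (hW : 2 ∣ W) (hn : n ≠ 0) (hco : n.Coprime W) : 0 < gAF n := by
  rw [gAF_apply hn]
  refine Finset.prod_pos fun p hp => ?_
  have hpp := Nat.prime_of_mem_primeFactors hp
  have hp2 : p ≠ 2 := by
    rintro rfl
    have : (2 : ℕ) ∣ Nat.gcd n W := Nat.dvd_gcd (Nat.dvd_of_mem_primeFactors hp) hW
    rw [hco] at this
    omega
  have h3 : 3 ≤ p := by
    have := hpp.two_le
    omega
  have : (3 : ℝ) ≤ p := by exact_mod_cast h3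
  linarith

/-- `Y = y`: for `Λ = λ(y)` and `(ψ, ρ) = (id, φ)` the diagonal variable is `y` itself
(Maynard's change of variables (5.8) is inverted by (5.10)). [cite: MaynardAnnals2015, (5.8)–(5.10)] -/
theorem Yv_lam_eq {W B : ℕ} {y : (Fin k → ℕ) → ℝ} (hy : SupportedOn W B y) (A : Fin k → ℕ) :
    Yv W B idAF totAF (lam B y) A = y A := by
  rw [Yv, Ssum]
  -- the sum over good tuples equals the sum over the box (`λ_d = 0` for non-good `d`)
  have hzero : ∀ d ∈ box k B, ¬IsGood W d → lam B y d = 0 := by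
    intro d _ hng
    rw [lam_def]
    refine mul_eq_zero_of_right _ (Finset.sum_eq_zero fun r hr => ?_)
    rw [Finset.mem_filter] at hr
    have : y r = 0 := by
      by_contra h
      exact hng ((hy r h).2.of_dvd hr.2)
    rw [this, zero_div]
  have hsum : ∑ d ∈ (boxG k W B).filter (fun d => ∀ i, A i ∣ d i), lam B y d / ∏ i, idAF (d i) =
      ∑ d ∈ (box k B).filter (fun d => ∀ i, A i ∣ d i), lam B y d / ∏ i, (d i : ℝ) := by
    simp only [idAF_apply]
    refine Finset.sum_subset (fun d hd => ?_) (fun d hd hnd => ?_)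
    · rw [Finset.mem_filter, mem_boxG] at hd
      exact Finset.mem_filter.2 ⟨hd.1.1, hd.2⟩
    · rw [Finset.mem_filter] at hd
      have hng : ¬IsGood W d := fun hg => hnd (Finset.mem_filter.2 ⟨mem_boxG.2 ⟨hd.1, hg⟩, hd.2⟩)
      rw [hzero d hd.1 hng, zero_div]
  rw [hsum, sum_lam_div_prod_eq hy A]
  simp only [totAF_apply]
  by_cases hyA : y A = 0
  · rw [hyA]; simp
  have hgood := (hy A hyA).2
  have hφ : (∏ i, ((A i).totient : ℝ)) ≠ 0 := Finset.prod_ne_zero_iff.2 fun i _ => by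
    have := Nat.totient_pos.2 (Nat.pos_of_ne_zero (hgood.ne_zero i))
    positivity
  have hμ2 : ∀ i, ((μ (A i) : ℤ) : ℝ) * ((μ (A i) : ℤ) : ℝ) = 1 := fun i => by
    have := ArithmeticFunction.moebius_sq_eq_one_of_squarefree (hgood.squarefree_apply i)
    rw [← sq]; exact_mod_cast this
  rw [Finset.prod_mul_distrib]
  rw [show (∏ i, ((μ (A i) : ℤ) : ℝ)) * (∏ i, ((A i).totient : ℝ)) *
      ((∏ i, ((μ (A i) : ℤ) : ℝ)) * y A / ∏ i, ((A i).totient : ℝ)) =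
      (∏ i, ((μ (A i) : ℤ) : ℝ) * ((μ (A i) : ℤ) : ℝ)) * y A by
    rw [Finset.prod_mul_distrib]; field_simp]
  simp [hμ2]


/-- `1 ≤ n` and hence `idAF n > 0` on `G1`. [folklore] -/
theorem idAF_pos_of_mem_G1 {W B n : ℕ} (hn : n ∈ G1 W B) : 0 < idAF n := by
  rw [idAF_apply]; exact_mod_cast (mem_G1.1 hn).1.1

/-- `φ(n) > 0` on `G1`. [folklore] -/
theorem totAF_pos_of_mem_G1 {W B n : ℕ} (hn : n ∈ G1 W B) : 0 < totAF n :=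
  totAF_pos (mem_G1.1 hn).1.1

/-- `g(n) > 0` on `G1` when `W` is even. [folklore] -/
theorem gAF_pos_of_mem_G1 {W B n : ℕ} (hW : 2 ∣ W) (hn : n ∈ G1 W B) : 0 < gAF n := by
  have h := mem_G1.1 hn
  exact gAF_pos hW (by have := h.1.1; omega) h.2.2

/-- **The main term of `S₁`** (Maynard 2015, Lemma 5.1, (5.6)–(5.14)): for `y` supported on good
tuples of the box `[1, B]^k` with `|y| ≤ y_max`,
`|Σ'_{d,e} λ_dλ_e/∏[dᵢ,eᵢ] − Σ_u y_u²/∏φ(uᵢ)| ≤ y_max² L^k (Z^K − 1)`,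
`L = Σ_{u ≤ B good} 1/φ(u)`, `Z = Σ_{s ≤ B good} 1/φ(s)²`, `K = k² − k`
(the sum `Σ'` over pairs of good tuples with `(dᵢ, eⱼ) = 1` for `i ≠ j`).
[cite: MaynardAnnals2015, Lemma 5.1, (5.6)–(5.14)] -/
theorem abs_S1main_sub_le {W B : ℕ} (hB : 1 ≤ B) {y : (Fin k → ℕ) → ℝ} (hy : SupportedOn W B y)
    {ymax : ℝ} (hymax : ∀ r, |y r| ≤ ymax) :
    |∑ d ∈ boxG k W B, ∑ e ∈ boxG k W B,
        (if ∀ p : OffDiag k, (d p.1.1).Coprime (e p.1.2) then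
          lam B y d * lam B y e / ∏ i, (Nat.lcm (d i) (e i) : ℝ) else 0) -
        ∑ u ∈ boxG k W B, y u ^ 2 / ∏ i, ((u i).totient : ℝ)| ≤
      ymax ^ 2 * (∑ n ∈ G1 W B, 1 / (n.totient : ℝ)) ^ k *
        ((∑ n ∈ G1 W B, 1 / (n.totient : ℝ) ^ 2) ^ Fintype.card (OffDiag k) - 1) := by
  have h := abs_bilinear_sub_diag_le (k := k) (W := W) (B := B) (ψ := idAF) (ρ := totAF)
    isMultiplicative_idAF isMultiplicative_totAF (fun n _ => sum_divisors_totAF n)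
    (fun _ hn => idAF_pos_of_mem_G1 hn) (fun _ hn => totAF_pos_of_mem_G1 hn) hB (lam B y)
    (Ymax := ymax) (fun A _ => by rw [Yv_lam_eq hy]; exact hymax A)
  simp only [Yv_lam_eq hy, idAF_apply, totAF_apply] at h
  exact h

/-- The coefficients of `S₂^{(m)}`: `λ_d [d_m = 1]` (Maynard 2015, (5.21): the sum defining
`y^{(m)}` runs over `d` with `d_m = 1`). [cite: MaynardAnnals2015, (5.21)] -/
noncomputable def lamM (B : ℕ) (y : (Fin k → ℕ) → ℝ) (m : Fin k) (d : Fin k → ℕ) : ℝ :=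
  if d m = 1 then lam B y d else 0

/-- Unfolding `lamM`. [folklore] -/
theorem lamM_def (B : ℕ) (y : (Fin k → ℕ) → ℝ) (m : Fin k) (d : Fin k → ℕ) :
    lamM B y m d = if d m = 1 then lam B y d else 0 := rfl

/-- **Maynard's `y^{(m)}`** ((5.21): `y^{(m)}_r = (∏ μ(rᵢ)g(rᵢ)) Σ_{rᵢ∣dᵢ, d_m=1} λ_d/∏φ(dᵢ)`),
as the diagonal variable of the pair `(φ, g)` for the coefficients `λ_d [d_m = 1]`.
[cite: MaynardAnnals2015, (5.21)] -/
noncomputable def ym (W B : ℕ) (y : (Fin k → ℕ) → ℝ) (m : Fin k) (u : Fin k → ℕ) : ℝ :=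
  Yv W B totAF gAF (lamM B y m) u

/-- Unfolding `ym`. [folklore] -/
theorem ym_def (W B : ℕ) (y : (Fin k → ℕ) → ℝ) (m : Fin k) (u : Fin k → ℕ) :
    ym W B y m u = (∏ i, ((μ (u i) : ℤ) : ℝ) * gAF (u i)) *
      ∑ d ∈ (boxG k W B).filter (fun d => ∀ i, u i ∣ d i), lamM B y m d / ∏ i, totAF (d i) := rfl

/-- **The main term of `S₂^{(m)}`** (Maynard 2015, Lemma 5.2, (5.22)–(5.26)): for `W` even and
`|y^{(m)}| ≤ y^{(m)}_max` on good tuples,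
`|Σ'_{d,e: d_m=e_m=1} λ_dλ_e/∏φ([dᵢ,eᵢ]) − Σ_u (y^{(m)}_u)²/∏g(uᵢ)| ≤ (y^{(m)}_max)² L_g^{k−1} (Z_g^K − 1)`,
`L_g = Σ_{u ≤ B good} 1/g(u)`, `Z_g = Σ_{s ≤ B good} 1/g(s)²` — the printed shape of (5.25): an error
which is `(Z_g^K − 1) ≪ k²/D₀` times the size `(y^{(m)}_max)² L_g^{k−1}` of the main term.
[cite: MaynardAnnals2015, Lemma 5.2, (5.22)–(5.26)] -/
theorem abs_S2main_sub_le {W B : ℕ} (hW : 2 ∣ W) (hB : 1 ≤ B) (y : (Fin k → ℕ) → ℝ) (m : Fin k)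
    {ymmax : ℝ} (hym : ∀ u ∈ boxG k W B, |ym W B y m u| ≤ ymmax) :
    |∑ d ∈ boxG k W B, ∑ e ∈ boxG k W B,
        (if ∀ p : OffDiag k, (d p.1.1).Coprime (e p.1.2) then
          lamM B y m d * lamM B y m e / ∏ i, totAF (Nat.lcm (d i) (e i)) else 0) -
        ∑ u ∈ boxG k W B, ym W B y m u ^ 2 / ∏ i, gAF (u i)| ≤
      ymmax ^ 2 * (∑ n ∈ G1 W B, 1 / gAF n) ^ (k - 1) *
        ((∑ n ∈ G1 W B, 1 / gAF n ^ 2) ^ Fintype.card (OffDiag k) - 1) :=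
  abs_bilinear_sub_diag_le_slot (k := k) (W := W) (B := B) (ψ := totAF) (ρ := gAF)
    isMultiplicative_totAF isMultiplicative_gAF (fun _ hn => sum_divisors_gAF (mem_G1.1 hn).2.1)
    (fun _ hn => totAF_pos_of_mem_G1 hn) (fun _ hn => gAF_pos_of_mem_G1 hW hn) hB (lamM B y m)
    (fun d hd => by
      by_contra h
      exact hd (by rw [lamM_def, if_neg h])) hym

end Bilinear

/-! ### Size of the weights: `λ_max ≤ y_max L^{2k}` -/

section LamBound

variable {W B : ℕ}

/-- `λ_d = 0` unless `d` is a good tuple of the box. [folklore] -/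
theorem lam_eq_zero_of_not {y : (Fin k → ℕ) → ℝ} (hy : SupportedOn W B y) {d : Fin k → ℕ}
    (hd : d ∉ boxG k W B) : lam B y d = 0 := by
  rw [lam_def]
  by_cases hbox : d ∈ box k B
  · have hng : ¬IsGood W d := fun hg => hd (mem_boxG.2 ⟨hbox, hg⟩)
    refine mul_eq_zero_of_right _ (Finset.sum_eq_zero fun r hr => ?_)
    rw [Finset.mem_filter] at hr
    have : y r = 0 := by
      by_contra h
      exact hng ((hy r h).2.of_dvd hr.2)
    rw [this, zero_div]
  · -- some `d i ∉ [1, B]`: either `d i = 0` (then `μ(0)·0 = 0`) or `d i > B` (empty sum)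
    rw [mem_box] at hbox
    push Not at hbox
    obtain ⟨i, hi⟩ := hbox
    by_cases h0 : d i = 0
    · refine mul_eq_zero_of_left ?_ _
      exact Finset.prod_eq_zero (Finset.mem_univ i) (by rw [h0]; simp)
    · refine mul_eq_zero_of_right _ (Finset.sum_eq_zero fun r hr => ?_)
      rw [Finset.mem_filter, mem_box] at hr
      have h1 : 1 ≤ d i := Nat.one_le_iff_ne_zero.2 h0
      have : B < d i := hi h1
      have : d i ≤ r i := Nat.le_of_dvd (hr.1 i).1 (hr.2 i)
      have := (hr.1 i).2
      omega

/-- `1/φ` as a multiplicative real arithmetic function. [folklore] -/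
noncomputable def invTotAF : ArithmeticFunction ℝ := ⟨fun n => 1 / (n.totient : ℝ), by simp⟩

/-- `1/φ` is multiplicative. [folklore] -/
theorem isMultiplicative_invTotAF : invTotAF.IsMultiplicative :=
  ⟨by simp [invTotAF], fun h => by
    simp only [invTotAF, ArithmeticFunction.coe_mk, Nat.totient_mul h, Nat.cast_mul]
    rw [one_div_mul_one_div]⟩

/-- For squarefree `d`: `Σ_{e ∣ d} 1/φ(e) = d/φ(d)` (`∏_{p∣d}(1 + 1/(p−1)) = ∏ p/(p−1)`).
[cite: MaynardAnnals2015, proof of (5.9) ("since d/φ(d) = Σ_{e∣d} 1/φ(e) for square-free d")] -/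
theorem sum_divisors_inv_totient {d : ℕ} (hd : Squarefree d) :
    ∑ e ∈ d.divisors, 1 / (e.totient : ℝ) = (d : ℝ) / d.totient := by
  have h := isMultiplicative_invTotAF.prodPrimeFactors_one_add_of_squarefree hd
  simp only [invTotAF, ArithmeticFunction.coe_mk] at h
  rw [← h]
  have hφ : (d.totient : ℝ) = ∏ p ∈ d.primeFactors, ((p : ℝ) - 1) := by
    have := isMultiplicative_totAF.prod_primeFactors hd
    rw [totAF_apply] at this
    rw [← this]
    refine Finset.prod_congr rfl fun p hp => ?_
    have hpp := Nat.prime_of_mem_primeFactors hp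
    rw [totAF_apply, Nat.totient_prime hpp, Nat.cast_sub hpp.one_lt.le, Nat.cast_one]
  have hdprod : (d : ℝ) = ∏ p ∈ d.primeFactors, (p : ℝ) := by
    rw [← Nat.cast_prod, Nat.prod_primeFactors_of_squarefree hd]
  rw [hφ, hdprod, ← Finset.prod_div_distrib]
  refine Finset.prod_congr rfl fun p hp => ?_
  have hpp := Nat.prime_of_mem_primeFactors hp
  have h2 : (2 : ℝ) ≤ p := by exact_mod_cast hpp.two_le
  have hp1 : (p : ℝ) - 1 ≠ 0 := by linarith
  rw [Nat.totient_prime hpp, Nat.cast_sub hpp.one_lt.le, Nat.cast_one]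
  field_simp
  ring

/-- `d/φ(d) ≤ L = Σ_{e ≤ B good} 1/φ(e)` for good scalars `d ≤ B`. [cite: MaynardAnnals2015, (5.9)] -/
theorem div_totient_le_L {d : ℕ} (hd : d ∈ G1 W B) :
    (d : ℝ) / d.totient ≤ ∑ e ∈ G1 W B, 1 / (e.totient : ℝ) := by
  rw [← sum_divisors_inv_totient (mem_G1.1 hd).2.1]
  refine Finset.sum_le_sum_of_subset_of_nonneg (fun e he => ?_) fun _ _ _ => by positivity
  exact mem_G1_of_dvd hd (Nat.dvd_of_mem_divisors he)

/-- **`λ_max ≤ y_max L^{2k}`** (a crude form of Maynard's (5.9) `λ_max ≪ y_max (log R)^k`):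
for `y` supported on good tuples of the box with `|y| ≤ y_max`,
`|λ_d| ≤ y_max (Σ_{e ≤ B good} 1/φ(e))^{2k}` for every `d`. [cite: MaynardAnnals2015, (5.9)] -/
theorem abs_lam_le {y : (Fin k → ℕ) → ℝ} (hy : SupportedOn W B y) {ymax : ℝ}
    (hymax : ∀ r, |y r| ≤ ymax) (d : Fin k → ℕ) :
    |lam B y d| ≤ ymax * (∑ e ∈ G1 W B, 1 / (e.totient : ℝ)) ^ (2 * k) := by
  have hy0 : 0 ≤ ymax := le_trans (abs_nonneg _) (hymax d)
  set L := ∑ e ∈ G1 W B, 1 / (e.totient : ℝ) with hL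
  have hL0 : 0 ≤ L := Finset.sum_nonneg fun _ _ => by positivity
  by_cases hd : d ∈ boxG k W B
  swap
  · rw [lam_eq_zero_of_not hy hd, abs_zero]; positivity
  have hdG := apply_mem_G1_of_mem_boxG hd
  have hdgood := (mem_boxG.1 hd).2
  -- `|λ_d| ≤ (∏ dᵢ) Σ_{d ∣ r good} |y_r| / ∏ φ(rᵢ)`
  rw [lam_def, abs_mul]
  have hprod : |∏ i, ((μ (d i) : ℤ) : ℝ) * (d i : ℝ)| = ∏ i, (d i : ℝ) := by
    rw [Finset.abs_prod]
    refine Finset.prod_congr rfl fun i _ => ?_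
    rw [abs_mul, Nat.abs_cast]
    have := ArithmeticFunction.abs_moebius_eq_one_of_squarefree (hdgood.squarefree_apply i)
    rw [← Int.cast_abs, show |μ (d i)| = 1 from this]; simp
  rw [hprod]
  -- restrict the `r`-sum to good tuples and substitute `r = d * t`
  have hsum : |∑ r ∈ (box k B).filter (fun r => ∀ i, d i ∣ r i), y r / ∏ i, ((r i).totient : ℝ)| ≤
      ymax * ((∏ i, 1 / ((d i).totient : ℝ)) * L ^ k) := by
    calc |∑ r ∈ (box k B).filter (fun r => ∀ i, d i ∣ r i), y r / ∏ i, ((r i).totient : ℝ)|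
        ≤ ∑ r ∈ (box k B).filter (fun r => ∀ i, d i ∣ r i), |y r| / ∏ i, ((r i).totient : ℝ) := by
          refine (Finset.abs_sum_le_sum_abs _ _).trans (Finset.sum_le_sum fun r _ => ?_)
          rw [abs_div, abs_of_nonneg (show (0 : ℝ) ≤ ∏ i, ((r i).totient : ℝ) from
            Finset.prod_nonneg fun i _ => by positivity)]
      _ = ∑ r ∈ (boxG k W B).filter (fun r => ∀ i, d i ∣ r i), |y r| / ∏ i, ((r i).totient : ℝ) := by
          symm
          refine Finset.sum_subset (fun r hr => ?_) fun r hr hnr => ?_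
          · rw [Finset.mem_filter, mem_boxG] at hr
            exact Finset.mem_filter.2 ⟨hr.1.1, hr.2⟩
          · rw [Finset.mem_filter] at hr
            have : y r = 0 := by
              by_contra h
              exact hnr (Finset.mem_filter.2 ⟨mem_boxG.2 ⟨hr.1, (hy r h).2⟩, hr.2⟩)
            rw [this, abs_zero, zero_div]
      _ ≤ ∑ r ∈ (boxG k W B).filter (fun r => ∀ i, d i ∣ r i), ymax / ∏ i, ((r i).totient : ℝ) := by
          refine Finset.sum_le_sum fun r _ => ?_
          exact div_le_div_of_nonneg_right (hymax r) (Finset.prod_nonneg fun i _ => by positivity)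
      _ = ymax * ∑ r ∈ (boxG k W B).filter (fun r => ∀ i, d i ∣ r i),
            ∏ i, 1 / ((r i).totient : ℝ) := by
          rw [Finset.mul_sum]
          refine Finset.sum_congr rfl fun r _ => ?_
          rw [div_eq_mul_one_div, one_div, ← Finset.prod_inv_distrib]
          simp only [one_div]
      _ ≤ ymax * ((∏ i, 1 / ((d i).totient : ℝ)) * L ^ k) := by
          refine mul_le_mul_of_nonneg_left ?_ hy0
          -- inject `r ↦ t = r / d` into `G1^k`, with `1/φ(rᵢ) = (1/φ(dᵢ)) (1/φ(tᵢ))`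
          have hinjOn : Set.InjOn (fun r : Fin k → ℕ => fun i => r i / d i)
              ((boxG k W B).filter (fun r => ∀ i, d i ∣ r i) : Set (Fin k → ℕ)) := by
            intro r hr r' hr' h
            rw [Finset.mem_coe, Finset.mem_filter] at hr hr'
            funext i
            have h1 := congrFun h i
            simp only at h1
            rw [Nat.div_eq_iff_eq_mul_left (Nat.pos_of_ne_zero (hdgood.ne_zero i)) (hr.2 i)] at h1
            rw [h1, Nat.div_mul_cancel (hr'.2 i)]
          have hinj : ∑ r ∈ (boxG k W B).filter (fun r => ∀ i, d i ∣ r i),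
              ∏ i, 1 / ((r i).totient : ℝ) ≤
              ∑ t ∈ Fintype.piFinset (fun _ : Fin k => G1 W B),
                (∏ i, 1 / ((d i).totient : ℝ)) * ∏ i, 1 / ((t i).totient : ℝ) := by
            calc ∑ r ∈ (boxG k W B).filter (fun r => ∀ i, d i ∣ r i), ∏ i, 1 / ((r i).totient : ℝ)
                = ∑ r ∈ (boxG k W B).filter (fun r => ∀ i, d i ∣ r i),
                    (∏ i, 1 / ((d i).totient : ℝ)) * ∏ i, 1 / (((r i / d i : ℕ)).totient : ℝ) := by
                  refine Finset.sum_congr rfl fun r hr => ?_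
                  rw [Finset.mem_filter] at hr
                  rw [← Finset.prod_mul_distrib]
                  refine Finset.prod_congr rfl fun i _ => ?_
                  have hri := (mem_boxG.1 hr.1).2.squarefree_apply i
                  obtain ⟨t, ht⟩ := hr.2 i
                  have hd0 : d i ≠ 0 := hdgood.ne_zero i
                  have hcop : (d i).Coprime t := Nat.coprime_of_squarefree_mul (ht ▸ hri)
                  rw [ht, Nat.mul_div_cancel_left _ (Nat.pos_of_ne_zero hd0), Nat.totient_mul hcop,
                    Nat.cast_mul, one_div_mul_one_div]
              _ = ∑ t ∈ ((boxG k W B).filter (fun r => ∀ i, d i ∣ r i)).image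
                    (fun r : Fin k → ℕ => fun i => r i / d i),
                    (∏ i, 1 / ((d i).totient : ℝ)) * ∏ i, 1 / ((t i).totient : ℝ) :=
                  (Finset.sum_image (f := fun t : Fin k → ℕ =>
                    (∏ i, 1 / ((d i).totient : ℝ)) * ∏ i, 1 / ((t i).totient : ℝ)) hinjOn).symm
              _ ≤ _ := by
                  refine Finset.sum_le_sum_of_subset_of_nonneg ?_ ?_
                  · intro t ht
                    rw [Finset.mem_image] at ht
                    obtain ⟨r, hr, rfl⟩ := ht
                    rw [Finset.mem_filter] at hr
                    rw [Fintype.mem_piFinset]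
                    intro i
                    exact mem_G1_of_dvd (apply_mem_G1_of_mem_boxG hr.1 i) (Nat.div_dvd_of_dvd (hr.2 i))
                  · intro t _ _
                    exact mul_nonneg (Finset.prod_nonneg fun i _ => by positivity)
                      (Finset.prod_nonneg fun i _ => by positivity)
          refine hinj.trans (le_of_eq ?_)
          rw [← Finset.mul_sum, ← Finset.prod_univ_sum (fun _ : Fin k => G1 W B)
            (fun _ n => 1 / (n.totient : ℝ)), Finset.prod_const, Finset.card_univ, Fintype.card_fin]
  calc (∏ i, (d i : ℝ)) * |∑ r ∈ (box k B).filter (fun r => ∀ i, d i ∣ r i),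
          y r / ∏ i, ((r i).totient : ℝ)|
      ≤ (∏ i, (d i : ℝ)) * (ymax * ((∏ i, 1 / ((d i).totient : ℝ)) * L ^ k)) :=
        mul_le_mul_of_nonneg_left hsum (Finset.prod_nonneg fun i _ => by positivity)
    _ = ymax * ((∏ i, (d i : ℝ) / (d i).totient) * L ^ k) := by
        rw [show (∏ i, (d i : ℝ) / (d i).totient) = (∏ i, (d i : ℝ)) * ∏ i, 1 / ((d i).totient : ℝ) by
          rw [← Finset.prod_mul_distrib]
          exact Finset.prod_congr rfl fun i _ => div_eq_mul_one_div _ _]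
        ring
    _ ≤ ymax * (L ^ k * L ^ k) := by
        refine mul_le_mul_of_nonneg_left (mul_le_mul_of_nonneg_right ?_ (pow_nonneg hL0 k)) hy0
        calc ∏ i, (d i : ℝ) / (d i).totient ≤ ∏ _i : Fin k, L :=
              Finset.prod_le_prod (fun i _ => by positivity) fun i _ => div_totient_le_L (hdG i)
          _ = L ^ k := by rw [Finset.prod_const, Finset.card_univ, Fintype.card_fin]
    _ = ymax * L ^ (2 * k) := by rw [two_mul, pow_add]

end LamBound

end MaynardSieve

end Literature.NumberTheory.Sieve
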